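import Literature.MathematicalPhysics.QuantumFieldTheory.Balaban1983to89.B15From190ConcreteC
import Literature.MathematicalPhysics.QuantumFieldTheory.Balaban1983to89.B15From190SectG

/-!
# `Balaban1983to89.B15Ineq198ConcreteC` — T. Bałaban, *Large field renormalization. I. The basic step of the 𝐑 operation*,
# Commun. Math. Phys. **122** (1989) 175–202 [Balaban1989LargeFieldI] = [IV], §1, (1.98) p. 200: the (190)-knitting of the LAST
# inequality of §1 with its two p. 199 `ℍ`-chains ON TWO BLOCK GEOMETRIES (§1), AT THE CONCRETE REMAINDER `C_h(U₁, ·)` OF [4] ON TWO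
# SINGLE-SCALE CUBE GEOMETRIES with all four (190)/mean-value pairs SUPPLIED BY NAME (§2), END TO END FROM THE LOCATED LEAVES OF
# [15] SECT. G for two abstract schemes on two geometries (§3), and (v1.1) with the Sect. C letters of both schemes from [15]
# PROPOSITION 3 (§4)

statement-level skeleton of published theorems with citation tags; proofs where landed; nothing here is a claim
about the Yang–Mills mass gap

CITATION HEADER (lean-in-tree rule 2026-08-18).  T. Bałaban, *Large field renormalization. I. The basic step of the 𝐑 operation*,
Commun. Math. Phys. **122**, 175–202 (1989), doi:10.1007/BF01257412, bib `Balaban1989LargeFieldI` (cell paper B15 = "[IV]"; PDF held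
`paper:balaban1989-cmp122-large-field-i`, journal page = PDF page + 174; pp. 199–200 = PDF 25–26, read by this seat as images on the x2
renders `run/shared/lean/pub/pub-balaban/b2b-balaban-ref1/pages/1989-cmp122-large-field-I/…-p025-x2.png`, `…-p026-x2.png`, page notes
`run/shared/lean/pub/lit-balaban/lit-balaban-r12/PAGES-r12.md`).  "[15]" = T. Bałaban, *The variational problem and background fields in
renormalization group method for lattice gauge theories*, Commun. Math. Phys. **102**, 277–309 (1985), bib `Balaban1985Variational` (cell
paper B11; Prop. 9 p. 309, (190) p. 308, (179)–(180) p. 306, (189) p. 308, (73) and Prop. 3 p. 289, (44)/(46) p. 285, (115) p. 295).  "[4]" =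
[Balaban1985Averaging] (CMP **98**) Props. 4–5 pp. 38–42 (the remainder `C_j(U₀, ·)`).  "[3]" = [Balaban1984PropagatorsII] Lemma 2.1 (2.61)
p. 234 (`B11SectG.RowSum`), (2.54) p. 233 (`Triangle254`).  Mega-formalization `lit-balaban`, HOME `run/shared/lean/pub/lit-balaban/`, unit
`lit-balaban-r12` gen 13 (reader/typer and fold owner of block B15; cell GAPS.md G-B15-r12-08 — this file is its Addendum 8 in the tree).

WHAT IS REPRODUCED.  SKELETON row **B15.Eq1.98** (with B15.Eq1.97, 1.80, 1.82) — cells only, head already `proved` (the displayed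
arithmetic is `B15Ineq196Proof.ineq198`, p251519; the (190)-knit with both p. 199 chains is `B15From190LayerSizes.ineq198_twoSup_of_ineq190_layer199`,
p304048; END TO END from [15] Sect. G on ONE geometry it is `B15From190SectG.ineq198_twoSup_layer199_sectG`, p308026).  THE PRINT (verbatim).
p. 199 [PDF 25]: *"The above field is equal to V″ outside the layer of thickness 2M₁ (in L^{−h}-scale) at the boundary ∂Ω_{h+1}. Denote this
layer by Σ. … This field can be bounded by 22d²max{1, L^{−2N}N^{1/2}O(1)B₃B₅M⁵(1+β₀)}ε_h + 2δ′_k ≦ … < 23d²ε_h. The ℍ-function in the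
expansion can be bounded on the domain Z″_{j+1}∖Z″_j for h < j < k, Z″_{h+1}∩Ω″^∼_{h+1} for j = h, and Ω^c_k∖Z″_k for j = k, by B₃exp(−δ(M/M₁)
(j−h))exp(−½δMR_h)23d²ε_h ≦ 23d²B₃(1+β₀)²(1+(j−h)^{β₀})exp(−(j−h))exp(−R_h)ε_j < αε_j. This yields the bound (1.91) with h replaced by j,
and the configuration U_{h,□}(V″) replaced by U(B″_{k,Z} ∪ B_h(Ω″^{∼2}_{h+1}), (exp iB′M˙(U₀^{(AL)})↾_{Σ^c}, M˙(U₀^{(AL)})↾_Σ)). (1.97) We expand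
the above function with respect to the variables B′. The corresponding ℍ-function can be bounded on the same domains as above by B₃δ′_k ≦
B₃(1+β₀)(1+(k−j)^{1/2})(A₁p₁(g_j))/(A₀p₀(g_j))ε_j < αε_j. The plaquette variables for the configuration (1.97) are bounded again as in (1.91),
with h replaced by j, and with U_{h,□}(V″) replaced by (1.97) for B′ = 0. This configuration is equal to U₀^{ū₀} … The plaquette variables
of U₀^{ū₀} satisfy the estimate (1.80). Combining the above estimates, and using the inequality ε_kη² ≦ (1+β₀)(k−j)^{1/2}L^{−2(k−j)}ε_j(L^{k−j}η)²
≦ L^{−(k−j)}ε_j(L^{k−j}η)² for j < k, we obtain"* p. 200 [PDF 26]: *"|U″_{k,Z}(∂p) − 1| < (2ε_kη² + O(1)B₃B₅M⁵exp(−δdist(p,Λ))ε_kη²)(1+L^{−j}αε_j)²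
+ (2+L^{−j}αε_j)(α+8α²ε_j)ε_j(L^{k−j}η)² ≦ (2L^{−(k−j)} + 4α + O(1)B₃B₅M⁵exp(−δdist(p,Λ))L^{−(k−j)})ε_j(L^{k−j}η)², (1.98) on the j-th domain
described above"*.  [15] (190) p. 308: *"|(δ/δB_ν(y′))𝓗_μ(B,x)|,
… ≦ O(1)[…]·(L^{j′}η)^{−d}exp(−⅛δ₀d(y,y′)) (190) for x ∈ Δ(y), … y ∈ Λ_j, y′ ∈ Λ_{j′}"*.

WHY A NEW FILE (the obstruction recorded in `B15From190ConcreteC` v1.1, HONEST SCOPE, p313602): the two `ℍ`-functions of p. 199 are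
two (179) charts of [15] with two argument-bond index sets — the bonds of the layer tower of `Σ` (chain 1) and the bonds carrying `B′`
(chain 2) —, hence, at r08's concrete `C_j` of [4], two single-scale cube geometries `cubeGeometry L h S T₁` / `cubeGeometry L h S T₂`
(the geometry's site type is built from the pair of bond sets), while the landed knit `B15From190LayerSizes.ineq198_twoSup_of_ineq190_layer199`
(§10 there) is stated on ONE block geometry `gB` shared by both chains.  In its proof the two chains never interact before the final
plaquette arithmetic: chain 1 uses (190), the [3] row sum, the localisation-as-geometry and the output presentation of ITS scheme, chain 2
likewise, and they meet in `B15Ineq196Proof.ineq198` at the plaquette `(x, μ, ν)` only.  §1 re-proves the knit with every geometric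
datum doubled; §2 and §3 are then the concrete-`C_h` and the Sect.-G-level assemblies in the pattern of `B15From190ConcreteC` §§5/7 and
`B15From190SectG` §8.

THE CHAIN, BY NAME (nothing restated, nothing modified).  §1: p29's `B15LayerSupSize.loc_layer199_le` (input size `< 23d²ε_h` of the
two-field layer tower), r12's `B15HDecayLeaves.boundH199B_of_ineq190` / `boundH199C_of_ineq190` (the two p. 199 `ℍ`-bounds from (190) in
block-majorant form), `B15Bounds199.chainB_le`/`chainB_lt`/`chainC_le`/`chainC_lt` (the printed chains), `B15GammaSmallness.exp_neg_R_le_gamma_sq`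
(`e^{−R_h} ≤ γ²`), r11's dictionary `B11SupSize190.norm_apply_apply_le_loc`/`loc_le_of_forall`, `B11SeminormSize190.norm_covDerivFwd_le_loc`,
p29's `B15Ineq191Lattice.ineq191_lattice_twoSup` (the (1.91)-shaped step, twice) and r12's `B15Ineq196Proof.ineq198` (the displayed
arithmetic, `α = 2α′`).  §2: r08 gen 11's `B11Ineq73HasMajConcrete.ineq190_and_hmv_supSize_concreteC_kernel` (p309726) and r12 gen 12's
`B11Ineq190DerivConcreteC.ineq190_and_hmv_covDerivBlockSize_concreteC_kernel` (p312211) PRODUCE, per scheme, the pair ((190) for the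
derivative functionals `t ↦ (x ↦ ev x) ∘ D𝓗(tB)`, mean-value domination) for the sup output size and for the covariant-derivative output
size at the CONCRETE remainder `C_h(Uᵢ, ·) = B11Eq44Concrete.Cmap L Uᵢ Sᵢ Tᵢ h` on `cubeGeometry L h Sᵢ Tᵢ` — inside them (190) itself
([15] Sect. G (182)–(190) for the actual Fréchet derivative, r08's `B11Ineq190Actual`), the mean-value reading (p29's `B11MeanValue190Chart`),
the (73) majorant (`hasMaj_fderiv_Dfix` from the H-kernel letter), [3] (2.54) (`triangle254_cubeGeometry`), (2.61) at `⅛δ₀`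
(`rowSum_cubeGeometry`), `hN`/`hBloc` (`loc_le_norm_supSize`/`norm_le_loc_of_isLoc`) and the Sect. C letters `hTm`/`hTm0` (r08's
`B11Ineq190FromProp3`, p06's `B11Prop3Concrete`) are DISCHARGED; the knit's own two row sums at the rates `aᵢδ₀ᵢ` are `rowSum_cubeGeometry`
(`c₀(δ₀ᵢ,aᵢ)ᵈ`), `hdistᵢ` is `dist_nonneg_cubeGeometry`.  §3: r08's `B11Ineq190Actual.ineq190_and_hmv_supSize_sectG` (p304614) and p29's
`B11Ineq190ActualDeriv.ineq190_and_hmv_covDerivBlockSize_sectG` (p306169) per scheme (private wrappers `pair_sup_sectG`/`pair_cov_sectG`,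
verbatim those of `B15From190SectG`, `hBloc` by r11's `B14From190SectG.norm_le_loc_supSize_of_isLoc`).

WHAT THIS FILE PROVES (kernel-checked, zero `sorry`; theorems only — no `def`, no new `Prop`, no named fact; axioms standard).
§0 (private) `exists_ne_zero_of_loc_ne_zero`, `const190_nonneg'`, `thetaD_nonneg`, `c0_pow_nonneg` (bookkeeping, as in the two parent files).
§1 `ineq198_twoSup_of_ineq190_layer199_twoGeom` — **(1.98) p. 200 on the lattice, both p. 199 `ℍ`-chains from (190) with their printed
   sizes, EACH CHAIN ON ITS OWN BLOCK GEOMETRY** `gB₁`, `gB₂` (own [3] row sum `RowSum gBᵢ σᵢ cᵢ`, rate `δ₀ᵢ`, (190) constant `Cᵢ` with one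
   printed `B₃ ≥ Cᵢ·cᵢ`, own output presentation `boxᵢ`/`blkᵢ`/`y₀ᵢ`/`Sᵢ` and block `yᵢ` of the plaquette); hypotheses and conclusion
   otherwise VERBATIM those of `B15From190LayerSizes.ineq198_twoSup_of_ineq190_layer199`, which is the diagonal `gB₁ = gB₂` of this theorem.
§2 `ineq198_twoSup_layer199_concreteC` — **(1.98) AT THE CONCRETE `C_h(U₁, ·)`, `C_h(U₂, ·)` OF [4]**: scheme 1 (the (1.97)-configuration
   chart, argument field = p29's two-field layer tower `B_f` of `Σ` indexed by the coarse bonds `T₁`) on `cubeGeometry L h S₁ T₁`, scheme 2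
   (the `B′`-expansion chart, argument field a free `B′ : T₂ → 𝔸` under (1.82)) on `cubeGeometry L h S₂ T₂`, the four pairs `h190ᵢ₀`/`hmvᵢ₀`
   (sup) and `h190ᵢ₁`/`hmvᵢ₁` (covariant derivatives at `Cc = C`, resp. `C₀`) SUPPLIED BY NAME; (190), mean value, (73), (2.54), (2.61)
   (both the `⅛δ₀ᵢ` and the knit's `aᵢδ₀ᵢ` row sums), `hdist`, `hN`/`hBloc`, `hTm`/`hTm0` DISCHARGED for both schemes.
§3 `ineq198_twoSup_layer199_twoGeom_sectG` — **(1.98) END TO END FROM THE LOCATED LEAVES OF [15] SECT. G, two abstract schemes on TWO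
   block geometries**: `B15From190SectG.ineq198_twoSup_layer199_sectG` with the geometry, (2.54), `δ₀`, the [3] datum `c`, the output
   presentation and the block of the plaquette no longer shared between the schemes (that theorem is the diagonal of this one).
§4 (v1.1) `ineq198_twoSup_layer199_twoGeom_of_inputs` — **§3 with the Sect. C letters of BOTH schemes from [15] Proposition 3**: `hTmᵢ`,
   `hTm0ᵢ` and the differentiability half of `hDfrᵢ` taken at `Dmᵢ := B11Prop3Model.Dfix Cmᵢ Hmᵢ C₂ᵢ` from Prop. 3's inputs
   (`B11Prop3Model.Inputs`), the analyticity of `Cmᵢ`, the printed smallness `18C₂ᵢB₀′ᵢε₃ᵢ ≤ 1`, `2ε₃ᵢ ≤ c₄ᵢ`, `ε₄ᵢ + 𝔞ᵢ ≤ ε₃ᵢ` (r08's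
   `B11Ineq190FromProp3.analyticOnNhd_Tm_of_le`/`Tm_zero`/`hasFDerivAt_Dfix_of_lt`/`norm_arg180_lt_eps3`); the (73) letter of each scheme
   is the decay majorant `h73ᵢ` of the actual derivative of `Dfix` — the (1.98) member of the `_of_inputs` pattern of `B15From190SectG` §9.
VERSIONS.  v1 = p315292 (commit 49fa144ec7a7; §§0–3).  v1.1 (this file) is APPEND-ONLY: no import added, §4 added, no v1 declaration,
statement or proof changed; DOCFIX at this touch (no statement change): the two sentences justifying the common scale `h` of §2's schemes
(§2 docstring, HONEST SCOPE below) now quote p. 199's *"the identity corresponding to (1.90)"* / *"the layer of thickness 2M₁ (in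
L^{−h}-scale)"* instead of *"(1.91) with h replaced by j"* (which concerns the output units, not the scale).
HONEST SCOPE.  Assembly of landed theorems BY NAME; no new analysis; the mathematical content of §1 is that of the landed §10 knit (its
proof, transcribed with the geometric data doubled).  MODEL-INSTANCE CHARACTER of §2 exactly as in `B15From190ConcreteC`: [15]'s `𝓗(B)`
belongs to the `h`-th renormalization transformation with its sequence of averagings and [3]'s multi-scale geometry; r08's concrete Sect. C
datum is the SINGLE-SCALE remainder `C_h(U, ·)` of [4] on `ℤᵈ` and `cubeGeometry L h S T` is ONE layer `Λ_h`; §2 is therefore the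
single-scale concrete instance of §3, not a construction of [IV]'s multi-scale `ℍ`.  The scale of both schemes is print's `h` (p. 199: *"We
write the identity corresponding to (1.90), with 𝔹_h(□^{∼4}) replaced by 𝔹″_{k,Z} ∪ 𝔹_h(Ω″^{∼2}_{h+1})"* and *"the layer of thickness 2M₁
(in L^{−h}-scale)"*: the `ℍ`-functions of p. 199 are those of the (1.90) identity of the `h`-th operation with a larger determining set, and
the tower of chain 1 has `h` levels; v1 quoted here *"(1.91) with h replaced by j"*, which concerns the output units — DOCFIX v1.1); print has ONE variational problem (1.97) expanded in two ways, so its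
case is `U₂ := U₁`, `S₂ := S₁` (and, in §3, one geometry) — the theorems keep the two schemes' data separate, which is more general and
costs nothing.  What is LEFT as hypothesis, exactly: in §1 — (190) for the four derivative functionals between the now concrete sizes, the
two row sums, the four mean-value dominations, the box/tower GEOMETRY (`hx…`/`hS…` for BOTH presentations, `hfar₁`, `hX`, `hgeom₁`), p29's
located lattice inputs ((1.96) `h96`, (1.80)-type `h80`, (D) `hD`/`hXc`/`hX1`/`hδr`/`hsmall`, (1.81)–(1.82) `h82`, relative block-axial
gauge `h19`, the regularity smallness `hs3`/`hs2`/`hs6`), the (B)/(C) chain letters of `B15Bounds199` (`hδM`, `hδM2`, `hflowB`, `hβ₀`, `hβ₁`;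
`hδ'k`, `hrk`, `hflowC`), the γ-data and the two α′-clauses (`hγB`, `hγC`), (1.80) `h180` for `C₀(∂p)`, `2α′ ≤ 1/8`, `0 ≤ L^{−j} ≤ 1`,
`ε_j ≤ 1/10`, the scale inequality `ε_kη² ≤ L_{kj}·ε_jξ²`, `L_{kj} ≤ 1`, the representation `hrep` of `C` over `C₀`, self-adjointness and
unitarity letters; in §2 additionally, per scheme, r08's located leaves of [15] Sect. G for the ABSTRACT `G̃ᵢ` (`hG190ᵢ`), `Δ⁽²⁾H₀ᵢ`
(`hD2H0ᵢ`), `H₀ᵢ` (`hH0ᵢ`), `Hmᵢ` (`hHᵢ`) as majorants between the cube sizes, (189) `h189ᵢ` (author-omitted, G-B11-G2), `q_G < 1`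
(`hqGᵢ`, constant `c₀(δ₀ᵢ,⅛)ᵈ`), the H-kernel letter `hHkerᵢ` with its smallness `hqᵢ`, the Sect. G `Regime`, `W`-analyticity, (46)
`‖Hmᵢ X‖ ≤ B₀′ᵢ‖X‖`, the Prop. 3 smallness in tree units (`h18ᵢ`, `h2ᵢ`, `hnestᵢ`), the [4] regime of `Uᵢ` (`hαᵢ…h155ᵢ`, `h ≤ kᵢ`), the
argument fields in the domain of (180) (`hdom₁`, `hdom₂`), the (115)-presentation letters `hevᵢ₀`/`hevᵢ₁` and the weights
`const190ᵢ·c₀(δ₀ᵢ,aᵢ)ᵈ ≤ B₃`; in §3 instead the abstract Sect.-G leaves of both schemes (`Regᵢ`, `hWaᵢ`, `hTmᵢ`/`hTm0ᵢ`, `hGᵢ`, `hD2H0ᵢ`,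
`hH0ᵢ`, `hHᵢ`, `h189ᵢ`, (73) `hDfrᵢ`, `hqᵢ`, `htriᵢ`, `hdomᵢ`) and the presentation letters `hevᵢ₀`/`hevᵢ₁`/`hNᵢ`, `hcoverᵢ`; in §4 the
same with `hTmᵢ`/`hTm0ᵢ`/the differentiability of `Dmᵢ` replaced by Prop. 3's inputs `hinᵢ`, `hCaᵢ`, the smallness `h18ᵢ`/`h2ᵢ`/`hnestᵢ` and
the (73) decay letter `h73ᵢ`.  p29's
HONEST SCOPE of the lattice models carries over verbatim (regularity on the finest cube of the tower only, `AvgClosed` value group,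
print's strict `<` sizes used as `≤`).  GAPS G-B15-r12-08: after this file EVERY (190)-knit of [IV] §1 — (1.31), (1.37)–(1.39), (1.42),
(1.45)–(1.48), (1.57)/(1.54)₂, (1.90)–(1.91), (1.96) AND (1.98) — exists in all three forms (lattice knit / Sect.-G end to end / concrete
`C_·` of [4]).  NOT summit progress.  r12 gen 13 (literature-prover-lit-balaban-r12-g13-0); v1 p315292, v1.1 same seat.
v1.2 (r12 gen 14, 2026-08-22): CITELOC DOCFIX ONLY — the three locators «(115) p.295» now read «(115) p.294» and «(49) p.286» reads «(49) p.285»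
([Balaban1985Variational] (115) = p. 294 PDF 18 l. 34, (117) opens p. 295; (49) = p. 285 PDF 9 l. 25, (53) opens p. 286; r08 gen-13 citeloc map,
re-run by this seat over the non-B11 files and re-read on the text layer); no declaration, statement or proof changed.
-/

noncomputable section

open scoped BigOperators NNReal
open NormedSpace Set

namespace Literature.MathematicalPhysics.QuantumFieldTheory.Balaban1983to89.B15Ineq198ConcreteC

open Literature.MathematicalPhysics.QuantumFieldTheory.Balaban1983to89
open MatrixLog B7Prop1Explicit B7Prop2Explicit B7Prop1Local B7Prop3Flat B7Prop4Flat B7Eq92Concrete B7Eq162General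
  B8Lemma1NonAbelian B8Ineq129 B8Ineq130 B8Ineq165Descent B15Ineq184BlockAxial B15Ineq184Local B8Eq115GaugeFixing
  B14ArgField36Lattice B15LayerLocal B15LayerSupSize
open B7Prop3GeneralLinear B7Prop4GeneralLevels B7Prop5GeneralOperators B7Prop5GeneralInduction B7Prop5GeneralLevels
  B7Prop5General B7Ineq149Pairing B13Contraction113 B11Eq44Concrete B11Prop3Model
open B6RandomWalk B11SectG B11SupSize190 B11SeminormSize190 B11Eq174Chart B11Eq183Differentiation B11Presentation190
  B11Ineq190Actual B11Ineq190ActualDeriv B11Ineq190FromProp3 B11Ineq73HasMajConcrete B15From190LayerSizes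
  B11Ineq190DerivConcreteC
open B15.Ineq194Flow

variable {d : ℕ}

/-! ## §0 Bookkeeping (private; as in `B15From190LayerSizes` / `B15From190ConcreteC` §0, private there) -/

/-- A nonzero sup size exhibits a nonzero value in the box (the `hD ↦ hfar` bookkeeping of `B15From190LayerSizes`, private
there). [folklore] -/
private theorem exists_ne_zero_of_loc_ne_zero {g : B6.Geometry} {X E : Type} [NormedAddCommGroup E] [Module ℝ E]
    {box : g.Site → Finset X} {blk : X → g.Site} {y : g.Site} {f : X → E}
    (h : (supSize g box blk : BlockNorm g (X → E)).loc y f ≠ 0) : ∃ x ∈ box y, f x ≠ 0 := by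
  by_contra hc
  refine h (le_antisymm (loc_le_of_forall le_rfl fun x hx => ?_) ((supSize g box blk : BlockNorm g (X → E)).loc_nonneg y f))
  rw [Classical.not_not.1 (fun hx' => hc ⟨x, hx, hx'⟩), norm_zero]

/-- The (190) constant `const190 κ_B κ_N κ₃ B_G θ_W c_Δ A₀ A_H θ_𝔇 c` of `B11SectG` is `≥ 0` for non-negative data under the
smallness `q < 1` of (187). [cite: Balaban1985Variational, (187)–(190) p.308] -/
private theorem const190_nonneg' {κB κN κ₃ BG θW cΔ A₀ AH θD c : ℝ} (hκB : 0 ≤ κB) (hκN : 0 ≤ κN) (hκ₃ : 0 ≤ κ₃)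
    (hc : 0 ≤ c) (hBG : 0 ≤ BG) (hθW : 0 ≤ θW) (hcΔ : 0 ≤ cΔ) (hA₀ : 0 ≤ A₀) (hAH : 0 ≤ AH) (hθD : 0 ≤ θD)
    (hq : qG κ₃ κN BG θW c < 1) : 0 ≤ const190 κB κN κ₃ BG θW cΔ A₀ AH θD c := by
  unfold const190
  have h₁ := constA0_nonneg (cΔ := cΔ) hκ₃ hκN hBG hθW hcΔ hA₀ hc hq
  positivity

/-- The (73) weight `θ_𝔇 = d·e^{½dδ₀}·(1 − q)⁻¹·e^{dδ₀}·C₃(Lʲ)²·2ε` of `B11Ineq73HasMajConcrete.hasMaj_fderiv_Dfix` is `≥ 0` under its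
smallness `q < 1`. [cite: Balaban1985Variational, (73) p.289] -/
private theorem thetaD_nonneg {L j : ℕ} {δ₀ ε B₁ : ℝ} (hε : 0 ≤ ε)
    (hq : (C3Gen d L * (((L : ℝ) ^ j) ^ 2 * (2 * ε)) * (2 * d) * B₁ * Real.exp (2 * d * δ₀)) * (d * B6.c0 δ₀ (1 / 2) ^ d) < 1) :
    (0 : ℝ) ≤ d * Real.exp (1 / 2 * d * δ₀) *
      ((1 - (C3Gen d L * (((L : ℝ) ^ j) ^ 2 * (2 * ε)) * (2 * d) * B₁ * Real.exp (2 * d * δ₀)) *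
          (d * B6.c0 δ₀ (1 / 2) ^ d))⁻¹ * (Real.exp (d * δ₀) * (C3Gen d L * ((L : ℝ) ^ j) ^ 2 * (2 * ε)))) := by
  have hC3 : 0 ≤ C3Gen d L := by unfold C3Gen C1ppGen; positivity
  have h1q : 0 < 1 - (C3Gen d L * (((L : ℝ) ^ j) ^ 2 * (2 * ε)) * (2 * d) * B₁ * Real.exp (2 * d * δ₀)) *
      (d * B6.c0 δ₀ (1 / 2) ^ d) := by linarith
  exact mul_nonneg (by positivity) (mul_nonneg (inv_nonneg.2 h1q.le) (by positivity))

/-- `0 ≤ c₀(δ₀, α)ᵈ` (the Lemma 2.1 [3] constant of the cube geometry). [cite: Balaban1984PropagatorsII, Lemma 2.1 (2.61) p.234] -/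
private theorem c0_pow_nonneg (δ₀ α : ℝ) (d : ℕ) : 0 ≤ B6.c0 δ₀ α ^ d :=
  pow_nonneg (tsum_nonneg fun _ => (Real.exp_pos _).le) d

/-! ## §1 (1.98) p. 200 on TWO block geometries: chain 1 (the (1.97)-configuration chart) on `gB₁`, chain 2 (the `B′`-expansion
chart) on `gB₂` -/

section TwoGeom

variable {gB₁ gB₂ : B6.Geometry} {X₁ X₂ : Type}
variable {𝔸 : Type} [CStarAlgebra 𝔸] [Nontrivial 𝔸]

/-- **(1.98) p. 200 ON THE LATTICE, BOTH p. 199 `ℍ`-CHAINS FROM [15] (190) WITH THEIR PRINTED SIZES, EACH CHAIN ON ITS OWN BLOCK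
GEOMETRY** — `B15From190LayerSizes.ineq198_twoSup_of_ineq190_layer199` (r12 gen 10, p304048) re-proved with the block geometry, the
[3] (2.61) row sum, the decay rate `δ₀`, the (190) constant and the output presentation (`box`, `blk`, `y₀`, `S`, the block `y` of the
plaquette) of chain 1 (index ₁: `U″_{k,Z} = (e^{iξℍ₁}C)^{g₁}` over the configuration `C` of (1.97), argument field p29's two-field layer
tower of the layer `Σ`, `h` levels, input size `< 23d²ε_h` by `loc_layer199_le`, printed exponent `δ(M/M₁)(j−h) + ½δMR_h ≤ τD₁`, the (B)
chain of `B15Bounds199` and the `R_h`-clause from γ) INDEPENDENT of those of chain 2 (index ₂: `C = (e^{iξℍ₂}C₀)^{g₂}` over `C₀ = U₀^{ū₀}`,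
argument field a free `B′` under (1.82) `‖B′ i‖ ≤ δ′_k`, global bound `B₃δ′_k`, the (C) chain).  The two chains meet only in the final
(1.98) arithmetic (`B15Ineq196Proof.ineq198`, `α = 2α′`) at the plaquette `(x, μ, ν)`, which must lie in the output box of `y₁` for
presentation 1 AND of `y₂` for presentation 2.  Everything else — the two-sup reading, the located side conditions, what is discharged
(both dictionaries, the localisation as geometry) and what is left ((190) for the four derivative functionals, the two row sums, the
four mean-value dominations, the box/tower geometry, p29's located lattice inputs, the γ-clauses, (1.80) for `C₀(∂p)`, `2α′ ≤ 1/8`, the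
scale inequality) — is VERBATIM §10 of `B15From190LayerSizes`; that theorem is the diagonal `gB₁ = gB₂`, shared presentation, of this one.
Purpose: the two charts of p. 199 are two schemes of [15] with two argument-bond index sets, hence — at the concrete `C_h` of [4] — two
cube geometries (§2).
[cite: Balaban1989LargeFieldI, (1.97)–(1.98) pp.199–200, (1.80) p.195, (1.82) p.196; Balaban1985Variational, (190) p.308; Balaban1984PropagatorsII, (2.61) p.234] -/
theorem ineq198_twoSup_of_ineq190_layer199_twoGeom
    -- chain 1: input index set / size, output presentation on `gB₁`
    (boxB₁ : gB₁.Site → Finset X₁) (blkB₁ : X₁ → gB₁.Site) (dep : X₁ → ℕ) (pt : X₁ → B7Prop1Explicit.Site d) (dir : X₁ → Fin d)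
    (box₁ : gB₁.Site → Finset (B7Prop1Explicit.Site d)) (blk₁ : B7Prop1Explicit.Site d → gB₁.Site)
    (y₀₁ : gB₁.Site) (S₁ : gB₁.Site → Finset (B7Prop1Explicit.Site d × Fin d × Fin d))
    -- chain 2: input index set / size, output presentation on `gB₂`
    (boxB₂ : gB₂.Site → Finset X₂) (blkB₂ : X₂ → gB₂.Site)
    (box₂ : gB₂.Site → Finset (B7Prop1Explicit.Site d)) (blk₂ : B7Prop1Explicit.Site d → gB₂.Site)
    (y₀₂ : gB₂.Site) (S₂ : gB₂.Site → Finset (B7Prop1Explicit.Site d × Fin d × Fin d))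
    {T₁ T₂ : Type*} {dH₁ : T₁ → (X₁ → 𝔸) →ₗ[ℝ] (B7Prop1Explicit.Site d → Fin d → 𝔸)}
    {dH₂ : T₂ → (X₂ → 𝔸) →ₗ[ℝ] (B7Prop1Explicit.Site d → Fin d → 𝔸)}
    {C₁ C₂ δ₀₁ δ₀₂ σ₁ σ₂ τ c₁ c₂ D₁ B₃ δ M M₁ εh εj εk δ'k γ gh β₀ α' rk rj s : ℝ} {r R : ℕ}
    {ξ : ℝ} {L : ℕ} {h k j : ℕ} {Cc C₀ : B7Prop1Explicit.Site d → Fin d → 𝔸ˣ}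
    -- (190) for chain 1 (background `C`, geometry 1) and chain 2 (background `C₀`, geometry 2), both output sizes
    (h190₁₀ : ∀ t, Ineq190 (supSize (X := X₁) (E := 𝔸) gB₁ boxB₁ blkB₁)
      (supSize (X := B7Prop1Explicit.Site d) (E := Fin d → 𝔸) gB₁ box₁ blk₁) (dH₁ t) C₁ δ₀₁)
    (h190₁₁ : ∀ t, Ineq190 (supSize (X := X₁) (E := 𝔸) gB₁ boxB₁ blkB₁) (covDerivBlockSize gB₁ y₀₁ S₁ ξ Cc) (dH₁ t) C₁ δ₀₁)
    (h190₂₀ : ∀ t, Ineq190 (supSize (X := X₂) (E := 𝔸) gB₂ boxB₂ blkB₂)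
      (supSize (X := B7Prop1Explicit.Site d) (E := Fin d → 𝔸) gB₂ box₂ blk₂) (dH₂ t) C₂ δ₀₂)
    (h190₂₁ : ∀ t, Ineq190 (supSize (X := X₂) (E := 𝔸) gB₂ boxB₂ blkB₂) (covDerivBlockSize gB₂ y₀₂ S₂ ξ C₀) (dH₂ t) C₂ δ₀₂)
    (hC₁ : 0 ≤ C₁) (hC₂ : 0 ≤ C₂)
    (hdist₁ : ∀ a b : gB₁.Site, 0 ≤ gB₁.dist a b) (hdist₂ : ∀ a b : gB₂.Site, 0 ≤ gB₂.dist a b)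
    (hrow₁ : RowSum gB₁ σ₁ c₁) (hτ : 0 ≤ τ) (hστ₁ : σ₁ + τ ≤ δ₀₁ / 8) (y₁ : gB₁.Site)
    (hrow₂ : RowSum gB₂ σ₂ c₂) (hσ₂ : σ₂ ≤ δ₀₂ / 8) (y₂ : gB₂.Site)
    -- chain 1's argument field: p29's two-field tower of the layer Σ (`loc_layer199_le`), `h` levels, fine fields `U′`, `U₀′`
    (hL : 2 ≤ L) (hd1 : 1 ≤ d) {G : Subgroup 𝔸ˣ} (hG : AvgClosed d L G) (hhk : h ≤ k)
    (U₀' U' : B7Prop1Explicit.Site d → Fin d → 𝔸ˣ) (hU₀' : ∀ x κ, U₀' x κ ∈ G) (hU' : ∀ x κ, U' x κ ∈ G)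
    {Cw Xc rr : ℝ} (hε : 0 < εh) (hCw : 0 ≤ Cw) (hδ0 : 0 ≤ δ'k) (lo hi : B7Prop1Explicit.Site d) (hlohi : lo ≤ hi)
    (h96 : pdevOn (tlo L lo h) (thi L hi h) U' < 3 / 4 * εh * (((L : ℝ) ^ h)⁻¹) ^ 2)
    (h80 : pdevOn (tlo L lo h) (thi L hi h) U₀' < Cw * εk * (((L : ℝ) ^ k)⁻¹) ^ 2)
    (hD : εk ≤ (1 + β₀) * Real.sqrt (k - h : ℕ) * εh)
    (hXc : Xc = (((L : ℝ) ^ (k - h)) ^ 2)⁻¹ * Real.sqrt (k - h : ℕ) * Cw * (1 + β₀)) (hX1 : Xc ≤ 1)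
    (hδr : δ'k ≤ (1 + β₀) * Real.sqrt (k - h : ℕ) * rr * εh)
    (hsmall : 2 * (1 + β₀) * Real.sqrt (k - h : ℕ) * rr < (d : ℝ) ^ 2)
    (hs3 : C0 d * εh ≤ 1 / 3) (hs2 : 2 * εh ≤ c2' d L) (hs6 : 11 * (d : ℝ) ^ 2 * εh + δ'k ≤ 1 / 6)
    (h19 : ∀ n, n < h → ∀ z, tlo L lo n ≤ z → z ≤ thi L hi n → ∀ r : Fin d → Fin L,
      axialFn (avgIter L U' (h - (n + 1))) ((L : ℤ) • z) ((L : ℤ) • z + boxVec L r) =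
        axialFn (avgIter L U₀' (h - (n + 1))) ((L : ℤ) • z) ((L : ℤ) • z + boxVec L r))
    (h82 : ∀ x ν, lo ≤ x → x + e ν ≤ hi →
      ‖((avgIter L U' h x ν * (avgIter L U₀' h x ν)⁻¹ : 𝔸ˣ) : 𝔸) - 1‖ ≤ δ'k)
    (hX : ∀ i, dep i ≤ h ∧ tlo L lo (dep i) ≤ pt i ∧ pt i + e (dir i) ≤ thi L hi (dep i))
    (hfar₁ : ∀ y' i, i ∈ boxB₁ y' → D₁ ≤ gB₁.dist y₁ y')
    -- chain 2's argument field: `B′` under (1.82)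
    (B' : X₂ → 𝔸) (hB' : ∀ i, ‖B' i‖ ≤ δ'k)
    -- the lattice data of p. 199–200: `U″_{k,Z} = (e^{iξℍ₁}C)^{g₁}`, `C = (e^{iξℍ₂}C₀)^{g₂}`
    (hξ : 0 < ξ) (hCc : ∀ z κ, Cc z κ ∈ U1 𝔸)
    {H₁ : B7Prop1Explicit.Site d → Fin d → 𝔸} (hH₁sa : ∀ z κ, IsSelfAdjoint (H₁ z κ))
    {g₁ : B7Prop1Explicit.Site d → 𝔸ˣ} (hg₁ : ∀ z, g₁ z ∈ U1 𝔸)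
    (hC₀ : ∀ z κ, C₀ z κ ∈ U1 𝔸)
    {H₂ : B7Prop1Explicit.Site d → Fin d → 𝔸} (hH₂sa : ∀ z κ, IsSelfAdjoint (H₂ z κ))
    {g₂ : B7Prop1Explicit.Site d → 𝔸ˣ} (hg₂ : ∀ z, g₂ z ∈ U1 𝔸)
    (hrep : Cc = gaugeAct g₂ (B8Lemma1NonAbelian.mulCfg (B8Eq146AExpansion.expCfg (B8Eq146AExpansion.iEta ξ H₂)) C₀))
    (μ ν : Fin d) (x : B7Prop1Explicit.Site d) {Linv η B₅ dist Cst Lkj : ℝ}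
    -- mean-value dominations (chain 1 w.r.t. `B₁` at the block `y₁` of geometry 1, chain 2 w.r.t. `B′` at `y₂` of geometry 2)
    (hmv₁₀ : ∀ s' : ℝ, (∀ t, (supSize (X := B7Prop1Explicit.Site d) (E := Fin d → 𝔸) gB₁ box₁ blk₁).loc y₁ (dH₁ t
        (fun i => mlog (((avgIter L U' (h - dep i) (pt i) (dir i) *
          (avgIter L U₀' (h - dep i) (pt i) (dir i))⁻¹ : 𝔸ˣ) : 𝔸)))) ≤ s') →
      (supSize (X := B7Prop1Explicit.Site d) (E := Fin d → 𝔸) gB₁ box₁ blk₁).loc y₁ H₁ ≤ s')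
    (hmv₁₁ : ∀ s' : ℝ, (∀ t, (covDerivBlockSize gB₁ y₀₁ S₁ ξ Cc).loc y₁ (dH₁ t
        (fun i => mlog (((avgIter L U' (h - dep i) (pt i) (dir i) *
          (avgIter L U₀' (h - dep i) (pt i) (dir i))⁻¹ : 𝔸ˣ) : 𝔸)))) ≤ s') →
      (covDerivBlockSize gB₁ y₀₁ S₁ ξ Cc).loc y₁ H₁ ≤ s')
    (hmv₂₀ : ∀ s' : ℝ, (∀ t, (supSize (X := B7Prop1Explicit.Site d) (E := Fin d → 𝔸) gB₂ box₂ blk₂).loc y₂ (dH₂ t B') ≤ s') →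
      (supSize (X := B7Prop1Explicit.Site d) (E := Fin d → 𝔸) gB₂ box₂ blk₂).loc y₂ H₂ ≤ s')
    (hmv₂₁ : ∀ s' : ℝ, (∀ t, (covDerivBlockSize gB₂ y₀₂ S₂ ξ C₀).loc y₂ (dH₂ t B') ≤ s') →
      (covDerivBlockSize gB₂ y₀₂ S₂ ξ C₀).loc y₂ H₂ ≤ s')
    -- chain 1: the printed localisation exponent and the (B) chain letters; one `B₃` dominating both (190) weights
    (hgeom₁ : δ * (M / M₁) * ((j - h : ℕ) : ℝ) + δ * M / 2 * (R : ℝ) ≤ τ * D₁)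
    (hCB₁ : C₁ * c₁ ≤ B₃) (hCB₂ : C₂ * c₂ ≤ B₃) (hB₃ : 0 < B₃)
    (hδM : 1 ≤ δ * (M / M₁)) (hδM2 : 1 ≤ δ * M / 2) (hεj : 0 < εj)
    (hflowB : εh ≤ (1 + β₀) ^ 2 * (1 + ((j - h : ℕ) : ℝ) ^ β₀) * εj) (hβ₀ : 0 < β₀) (hβ₁ : β₀ ≤ 1)
    -- γ data: (2.5) for `R_h`, `0 < g_h ≤ γ`, `log γ⁻² ≥ 1`, the two α′-clauses
    (hr : 1 ≤ r) (hR : B14.IsRj L r gh R) (hgh : 0 < gh) (hgγ : gh ≤ γ) (hγe : 1 ≤ Real.log (γ ^ 2)⁻¹)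
    (hγB : 23 * (d : ℝ) ^ 2 * B₃ * (1 + β₀) ^ 2 * γ ^ 2 < α')
    -- chain 2: the (C) chain letters
    (hεk : 0 ≤ εk) (hrj : 0 ≤ rj) (hs0 : 0 ≤ s) (hδ'k : δ'k ≤ rk * εk) (hrk : rk ≤ rj)
    (hflowC : εk ≤ (1 + β₀) * (1 + s) * εj) (hγC : B₃ * (1 + β₀) * (1 + s) * rj < α')
    -- the output dictionaries as set geometry: the plaquette in the box of `y₁` (presentation 1) AND of `y₂` (presentation 2)
    (hx₁ : x ∈ box₁ y₁) (hxμ₁ : x + e μ ∈ box₁ y₁) (hxν₁ : x + e ν ∈ box₁ y₁)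
    (hS₁₁ : (x, μ, ν) ∈ S₁ y₁) (hS₂₁ : (x, ν, μ) ∈ S₁ y₁)
    (hx₂ : x ∈ box₂ y₂) (hxμ₂ : x + e μ ∈ box₂ y₂) (hxν₂ : x + e ν ∈ box₂ y₂)
    (hS₁₂ : (x, μ, ν) ∈ S₂ y₂) (hS₂₂ : (x, ν, μ) ∈ S₂ y₂)
    -- the located inputs of `ineq198_lattice`: (1.80) for `C₀(∂p)`, α ≤ 1/8, signs, the scale inequality
    (h180 : B15.Ineq180 ‖B8Ineq132.plaqF C₀ μ ν x - 1‖ εk η B₃ B₅ M δ dist Cst)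
    (hα' : 2 * α' ≤ 1 / 8) (hL0 : 0 ≤ Linv) (hL1 : Linv ≤ 1) (hε1 : εj ≤ 1 / 10)
    (hXst : 0 ≤ Cst * B₃ * B₅ * M ^ 5 * Real.exp (-δ * dist)) (he : 0 ≤ εk * η ^ 2)
    (hscale : εk * η ^ 2 ≤ Lkj * (εj * ξ ^ 2)) (hLkj1 : Lkj ≤ 1) :
    ‖B8Ineq132.plaqF (gaugeAct g₁ (B8Lemma1NonAbelian.mulCfg (B8Eq146AExpansion.expCfg
        (B8Eq146AExpansion.iEta ξ H₁)) Cc)) μ ν x - 1‖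
      < (2 * Lkj + 4 * (2 * α') + Cst * (1 + Linv * (2 * α') * εj) ^ 2 * B₃ * B₅ * M ^ 5 * Real.exp (-δ * dist) * Lkj)
        * (εj * ξ ^ 2) := by
  have hκ₁ : C₁ * (supSize (X := X₁) (E := 𝔸) gB₁ boxB₁ blkB₁).κ * c₁ ≤ B₃ := by rw [supSize_κ, mul_one]; exact hCB₁
  have hκ₂ : C₂ * (supSize (X := X₂) (E := 𝔸) gB₂ boxB₂ blkB₂).κ * c₂ ≤ B₃ := by rw [supSize_κ, mul_one]; exact hCB₂
  -- chain 1 (geometry 1): input size 23d²ε_h (p29), localisation as geometry, (190) ⇒ the printed ℍ-bound, then the (B) chain < α′ε_j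
  have hm₁ := loc_layer199_le (box := boxB₁) (blk := blkB₁) dep pt dir L hL hd1 hG hhk U₀' U' hU₀' hU' hε hCw hδ0 lo hi hlohi
    h96 h80 hD hXc hX1 hδr hsmall hs3 hs2 hs6 h19 h82 hX
  have hD₁ : ∀ y', (supSize (X := X₁) (E := 𝔸) gB₁ boxB₁ blkB₁).loc y'
      (fun i => mlog (((avgIter L U' (h - dep i) (pt i) (dir i) *
        (avgIter L U₀' (h - dep i) (pt i) (dir i))⁻¹ : 𝔸ˣ) : 𝔸))) ≠ 0 → D₁ ≤ gB₁.dist y₁ y' :=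
    fun y' hne => by obtain ⟨i, hi, -⟩ := exists_ne_zero_of_loc_ne_zero hne; exact hfar₁ y' i hi
  have hb₁₀ := B15HDecayLeaves.boundH199B_of_ineq190 h190₁₀ hC₁ hdist₁ hrow₁ hτ hστ₁ _ y₁ hm₁ hD₁ hmv₁₀ hgeom₁ hκ₁ hB₃.le
    hε.le
  have hb₁₁ := B15HDecayLeaves.boundH199B_of_ineq190 h190₁₁ hC₁ hdist₁ hrow₁ hτ hστ₁ _ y₁ hm₁ hD₁ hmv₁₁ hgeom₁ hκ₁ hB₃.le
    hε.le
  have hRh : (0 : ℝ) ≤ (R : ℝ) := Nat.cast_nonneg R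
  have hlarge : 23 * (d : ℝ) ^ 2 * B₃ * (1 + β₀) ^ 2 * Real.exp (-(R : ℝ)) < α' := by
    have h1 := B15GammaSmallness.exp_neg_R_le_gamma_sq hr hR hgh hgγ hγe
    have h2 := mul_le_mul_of_nonneg_left h1 (show 0 ≤ 23 * (d : ℝ) ^ 2 * B₃ * (1 + β₀) ^ 2 by positivity)
    exact h2.trans_lt hγB
  have hs₁₀ : (supSize (X := B7Prop1Explicit.Site d) (E := Fin d → 𝔸) gB₁ box₁ blk₁).loc y₁ H₁ < α' * εj :=
    (hb₁₀.trans (B15Bounds199.chainB_le (j - h) hB₃.le hδM hδM2 hRh hε.le hεj.le hflowB)).trans_lt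
      (B15Bounds199.chainB_lt (j - h) hB₃.le hβ₀ hβ₁ hεj hlarge)
  have hs₁₁ : (covDerivBlockSize gB₁ y₀₁ S₁ ξ Cc).loc y₁ H₁ < α' * εj :=
    (hb₁₁.trans (B15Bounds199.chainB_le (j - h) hB₃.le hδM hδM2 hRh hε.le hεj.le hflowB)).trans_lt
      (B15Bounds199.chainB_lt (j - h) hB₃.le hβ₀ hβ₁ hεj hlarge)
  -- chain 2 (geometry 2): input size δ′_k from (1.82), (190) globally ⇒ B₃δ′_k, then the (C) chain < α′ε_j
  have hm₂ : ∀ y', (supSize (X := X₂) (E := 𝔸) gB₂ boxB₂ blkB₂).loc y' B' ≤ δ'k :=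
    fun y' => loc_le_of_forall hδ0 fun i _ => hB' i
  have hb₂₀ := B15HDecayLeaves.boundH199C_of_ineq190 h190₂₀ hC₂ hdist₂ hrow₂ hσ₂ B' y₂ hm₂ hmv₂₀ hκ₂
  have hb₂₁ := B15HDecayLeaves.boundH199C_of_ineq190 h190₂₁ hC₂ hdist₂ hrow₂ hσ₂ B' y₂ hm₂ hmv₂₁ hκ₂
  have hs₂₀ : (supSize (X := B7Prop1Explicit.Site d) (E := Fin d → 𝔸) gB₂ box₂ blk₂).loc y₂ H₂ < α' * εj :=
    (hb₂₀.trans (B15Bounds199.chainC_le hB₃.le hεk hrj hδ'k hrk hflowC)).trans_lt (B15Bounds199.chainC_lt hγC hεj)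
  have hs₂₁ : (covDerivBlockSize gB₂ y₀₂ S₂ ξ C₀).loc y₂ H₂ < α' * εj :=
    (hb₂₁.trans (B15Bounds199.chainC_le hB₃.le hεk hrj hδ'k hrk hflowC)).trans_lt (B15Bounds199.chainC_lt hγC hεj)
  -- the two (1.91)-shaped steps of p. 199 (two-sup reading), then the (1.98) arithmetic with α = 2α′
  set Y₁ := max ((supSize (X := B7Prop1Explicit.Site d) (E := Fin d → 𝔸) gB₁ box₁ blk₁).loc y₁ H₁)
    ((covDerivBlockSize gB₁ y₀₁ S₁ ξ Cc).loc y₁ H₁) with hY₁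
  set Y₂ := max ((supSize (X := B7Prop1Explicit.Site d) (E := Fin d → 𝔸) gB₂ box₂ blk₂).loc y₂ H₂)
    ((covDerivBlockSize gB₂ y₀₂ S₂ ξ C₀).loc y₂ H₂) with hY₂
  have hY₁lt : Y₁ < α' * εj := max_lt hs₁₀ hs₁₁
  have hY₂lt : Y₂ < α' * εj := max_lt hs₂₀ hs₂₁
  have h1 := B15Ineq191Lattice.ineq191_lattice_twoSup hξ hCc hH₁sa hg₁ μ ν x
    ((norm_apply_apply_le_loc hx₁ H₁ μ).trans (le_max_left _ _))
    ((norm_apply_apply_le_loc hxμ₁ H₁ ν).trans (le_max_left _ _))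
    ((norm_apply_apply_le_loc hxν₁ H₁ μ).trans (le_max_left _ _))
    ((norm_apply_apply_le_loc hx₁ H₁ ν).trans (le_max_left _ _))
    ((norm_covDerivFwd_le_loc hS₁₁ H₁).trans (le_max_right _ _))
    ((norm_covDerivFwd_le_loc hS₂₁ H₁).trans (le_max_right _ _)) hY₁lt hεj.le hL0
  have h2 := B15Ineq191Lattice.ineq191_lattice_twoSup hξ hC₀ hH₂sa hg₂ μ ν x
    ((norm_apply_apply_le_loc hx₂ H₂ μ).trans (le_max_left _ _))
    ((norm_apply_apply_le_loc hxμ₂ H₂ ν).trans (le_max_left _ _))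
    ((norm_apply_apply_le_loc hxν₂ H₂ μ).trans (le_max_left _ _))
    ((norm_apply_apply_le_loc hx₂ H₂ ν).trans (le_max_left _ _))
    ((norm_covDerivFwd_le_loc hS₁₂ H₂).trans (le_max_right _ _))
    ((norm_covDerivFwd_le_loc hS₂₂ H₂).trans (le_max_right _ _)) hY₂lt hεj.le hL0
  rw [← hrep] at h2
  have hα0 : 0 ≤ 2 * α' := by
    have h0 : 0 ≤ B₃ * (1 + β₀) * (1 + s) * rj := by positivity
    linarith [h0.trans_lt hγC]
  exact B15Ineq196Proof.ineq198 h1 h2 h180 hα0 hα' hL0 hL1 hεj.le hε1 (by positivity) hXst he hscale hLkj1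

end TwoGeom

/-! ## §2 (1.98) p. 200 AT THE CONCRETE `C_h` OF [4]: both schemes concrete, on the two single-scale cube geometries of their
argument-bond index sets `T₁` (the layer tower of `Σ`) and `T₂` (the bonds carrying `B′`) -/

section Eq198C

variable {𝔸 : Type} [CStarAlgebra 𝔸] [Nontrivial 𝔸]

variable (L : ℕ) (hL : 2 ≤ L) {G : Subgroup 𝔸ˣ} (hAG : AvgClosed d L G)
  -- the [4] regime of scheme 1: background `U₁` of `C_h(U₁, ·)`, regular up to the level `k₁ ≥ h`
  (k₁ : ℕ) (U₁ : B7Prop1Explicit.Site d → Fin d → 𝔸ˣ) (hU₁ : ∀ x κ, U₁ x κ ∈ G) {α₁ : ℝ} (hα₁ : 0 < α₁)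
  (hα₁3 : C0 d * α₁ ≤ 1 / 3) (hα₁4 : 4 * α₁ ≤ c2' d L) (h52₁ : pdev U₁ < α₁ * (((L : ℝ) ^ k₁)⁻¹) ^ 2)
  {b₁ : ℝ} (hb₁ : 0 < b₁)
  (hsmall₁ : Real.exp (4 * (800 * ((d : ℝ) + 1) ^ 2 * ((d : ℝ) + 4)) * α₁)
    * (1 + 8 * (131072 * ((d : ℝ) + 1) ^ 2) * ((L : ℝ) ^ k₁ * b₁)) ≤ 2)
  (hc₃₁ : 4 * ((L : ℝ) ^ k₁ * b₁) < c3 d L)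
  (h145₁ : 8 * d * thetaGen d L α₁ * (L : ℝ)⁻¹ ^ 4 ≤ 1)
  (h155₁ : (2 * (L : ℝ) - 1) * (L : ℝ)⁻¹ ^ 2 + 2 * d * thetaGen d L α₁ * (L : ℝ)⁻¹ ^ 3
    + 1 / 8 * (1 + 2 * d * thetaGen d L α₁ * (L : ℝ)⁻¹ ^ 2 + 2 * d * C3Gen d L * ((L : ℝ) ^ k₁ * b₁)) * (L : ℝ)⁻¹ ^ 2 ≤ 1)
  (S₁ T₁ : Finset (B7Prop1Explicit.Site d × Fin d))
  -- the [4] regime of scheme 2: background `U₂` of `C_h(U₂, ·)`, regular up to the level `k₂ ≥ h`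
  (k₂ : ℕ) (U₂ : B7Prop1Explicit.Site d → Fin d → 𝔸ˣ) (hU₂ : ∀ x κ, U₂ x κ ∈ G) {α₂ : ℝ} (hα₂ : 0 < α₂)
  (hα₂3 : C0 d * α₂ ≤ 1 / 3) (hα₂4 : 4 * α₂ ≤ c2' d L) (h52₂ : pdev U₂ < α₂ * (((L : ℝ) ^ k₂)⁻¹) ^ 2)
  {b₂ : ℝ} (hb₂ : 0 < b₂)
  (hsmall₂ : Real.exp (4 * (800 * ((d : ℝ) + 1) ^ 2 * ((d : ℝ) + 4)) * α₂)
    * (1 + 8 * (131072 * ((d : ℝ) + 1) ^ 2) * ((L : ℝ) ^ k₂ * b₂)) ≤ 2)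
  (hc₃₂ : 4 * ((L : ℝ) ^ k₂ * b₂) < c3 d L)
  (h145₂ : 8 * d * thetaGen d L α₂ * (L : ℝ)⁻¹ ^ 4 ≤ 1)
  (h155₂ : (2 * (L : ℝ) - 1) * (L : ℝ)⁻¹ ^ 2 + 2 * d * thetaGen d L α₂ * (L : ℝ)⁻¹ ^ 3
    + 1 / 8 * (1 + 2 * d * thetaGen d L α₂ * (L : ℝ)⁻¹ ^ 2 + 2 * d * C3Gen d L * ((L : ℝ) ^ k₂ * b₂)) * (L : ℝ)⁻¹ ^ 2 ≤ 1)
  (S₂ T₂ : Finset (B7Prop1Explicit.Site d × Fin d))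

variable {𝒵₁ : Type} [NormedAddCommGroup 𝒵₁] [NormedSpace ℂ 𝒵₁] [CompleteSpace 𝒵₁]
  {𝒢₁ : 𝒵₁ →L[ℂ] (S₁ → 𝔸)} {W₁ : (S₁ → 𝔸) → 𝒵₁} {D2₁ : (S₁ → 𝔸) →L[ℂ] 𝒵₁} {H₀₁ : (T₁ → 𝔸) →L[ℂ] (S₁ → 𝔸)}
  {B₀₁ θ₁ C₄₁ a₃₁ 𝔧₁ 𝔞₁ ε₄₁ : ℝ}
variable {𝒵₂ : Type} [NormedAddCommGroup 𝒵₂] [NormedSpace ℂ 𝒵₂] [CompleteSpace 𝒵₂]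
  {𝒢₂ : 𝒵₂ →L[ℂ] (S₂ → 𝔸)} {W₂ : (S₂ → 𝔸) → 𝒵₂} {D2₂ : (S₂ → 𝔸) →L[ℂ] 𝒵₂} {H₀₂ : (T₂ → 𝔸) →L[ℂ] (S₂ → 𝔸)}
  {B₀₂ θ₂ C₄₂ a₃₂ 𝔧₂ 𝔞₂ ε₄₂ : ℝ}

include hL hAG hU₁ hα₁ hα₁3 hα₁4 h52₁ hb₁ hsmall₁ hc₃₁ h145₁ h155₁ hU₂ hα₂ hα₂3 hα₂4 h52₂ hb₂ hsmall₂ hc₃₂ h145₂ h155₂ in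
/-- **(1.98) p. 200 ON THE LATTICE, AT THE CONCRETE REMAINDERS `C_h(U₁, ·)`, `C_h(U₂, ·)` OF [4] ON TWO SINGLE-SCALE CUBE GEOMETRIES, ALL
FOUR (190)/MEAN-VALUE PAIRS SUPPLIED BY NAME** — §1's two-geometry knit `ineq198_twoSup_of_ineq190_layer199_twoGeom` with: SCHEME 1
(chain 1, the (1.97)-configuration chart `U″_{k,Z} = (e^{iξℍ₁}C)^{g₁}`): the presented (179) chart `ℍ₁ = x ↦ ev₁ x (𝓗₁(B_f))`,
`𝓗₁ = chartH179 𝒢₁ W₁ D2₁ H₀₁ Tm₁ ε₄₁`, Sect. C map `Tm₁ = · − Hm₁(Dfix(C_h(U₁,·)) ·)` at the CONCRETE `C_h(U₁, ·) = B11Eq44Concrete.Cmap L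
U₁ S₁ T₁ h`, argument field `B_f` = p29's two-field layer tower of the layer `Σ` (fine fields `U′`, `U₀′`, `h` levels) INDEXED BY THE COARSE
BONDS `T₁`, geometry `cubeGeometry L h S₁ T₁`, input size the coarse sup size; its pair (sup output size / covariant derivatives at `Cc = C`)
from r08's `B11Ineq73HasMajConcrete.ineq190_and_hmv_supSize_concreteC_kernel` / r12's
`B11Ineq190DerivConcreteC.ineq190_and_hmv_covDerivBlockSize_concreteC_kernel`.  SCHEME 2 (chain 2, the `B′`-expansion chart `C =
(e^{iξℍ₂}C₀)^{g₂}`, `C₀ = U₀^{ū₀}`): likewise with index ₂, argument field a free `B′ : T₂ → 𝔸` under (1.82) `‖B′ i‖ ≤ δ′_k`, geometry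
`cubeGeometry L h S₂ T₂`, covariant derivatives at `C₀`.  Per scheme (190) itself, the mean-value reading, the (73) majorant (from the
H-kernel letter `hHker`), [3] (2.54), (2.61) at `⅛δ₀ᵢ` (`c₀(δ₀ᵢ,⅛)ᵈ`), `hN`/`hBloc`, `hTm`/`hTm0` are DISCHARGED inside those theorems; the
knit's own (2.61) at the rate `σᵢ = aᵢδ₀ᵢ` is `rowSum_cubeGeometry` (`c₀(δ₀ᵢ,aᵢ)ᵈ`), `hdistᵢ` is `dist_nonneg_cubeGeometry`, and one printed
`B₃` dominates both explicit weights `const190ᵢ · c₀(δ₀ᵢ,aᵢ)ᵈ` (`hCB₁`, `hCB₂`).  The scale of both schemes is print's `h` (p. 199: *"We write the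
identity corresponding to (1.90), with 𝔹_h(□^{∼4}) replaced by 𝔹″_{k,Z} ∪ 𝔹_h(Ω″^{∼2}_{h+1})"*, the expanded field living on *"the layer of
thickness 2M₁ (in L^{−h}-scale)"* — i.e. the `ℍ`-functions are those of the (1.90) identity of the `h`-th operation with a larger determining
set; v1's parenthesis here quoted *"the bound (1.91) with h replaced by j"*, which concerns the OUTPUT units `ε_j(L^{k−j}η)²`, not the scale —
DOCFIX v1.1); the two [4] backgrounds `U₁`, `U₂`, fine bond sets `S₁`, `S₂` and scheme operators are kept separate (print: ONE variational
problem (1.97) expanded in two ways — instantiate `U₂ := U₁`, `S₂ := S₁`).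
What is LEFT, exactly: (i) per scheme, r08's located leaves of [15] Sect. G for the ABSTRACT `G̃ᵢ`/`Δ⁽²⁾H₀ᵢ`/`H₀ᵢ`/`Hmᵢ` as majorants between
the cube sizes (`hG190ᵢ`, `hD2H0ᵢ`, `hH0ᵢ`, `hHᵢ`), (189) `h189ᵢ`, `q_G < 1` (`hqGᵢ`), the H-kernel letter `hHkerᵢ` with `hqᵢ`, the Sect. G
`Regime`, `W`-analyticity, (46), the Prop. 3 smallness in tree units, the [4] regime of `Uᵢ`, the argument field in the domain of (180)
(`hdom₁`, `hdom₂`); (ii) the (115)-presentation letters `hev₁₀`/`hev₁₁`, `hev₂₀`/`hev₂₁`; (iii) the knit's side conditions VERBATIM (p29's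
located inputs (1.96) `h96`, (1.80)-type `h80`, (D), (1.81)–(1.82) `h82`, relative block-axial gauge `h19`, tower geometry `hX`, `hfar₁` in
the cube distance of geometry 1, `hgeom₁`, the (B)/(C) chain letters of `B15Bounds199`, the two α′-clauses from γ, (1.80) `h180` for
`C₀(∂p)`, `2α′ ≤ 1/8`, the scale inequality, membership of the plaquette data in BOTH presentations).  Model-instance character as in
`B15From190ConcreteC` (single-scale concrete instances of the Sect.-G theorem `B15From190SectG.ineq198_twoSup_layer199_sectG`).
[cite: Balaban1989LargeFieldI, (1.97)–(1.98) pp.199–200, (1.80) p.195, (1.82) p.196; Balaban1985Variational, Prop. 9 (190) pp.308–309, (179)–(180) p.306, (73) p.289, (44) p.285, (115) p.294; Balaban1984PropagatorsII, Lemma 2.1 (2.61) p.234] -/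
theorem ineq198_twoSup_layer199_concreteC {h : ℕ} (hh₁ : h ≤ k₁) (hh₂ : h ≤ k₂) (hd1 : 1 ≤ d)
    -- scheme 1: Sect. G regime and letters at the concrete `C_h(U₁, ·)`
    (Reg₁ : Regime 𝒢₁ 0 W₁ B₀₁ θ₁ C₄₁ a₃₁ 𝔧₁ 𝔞₁ ε₄₁) (hWa₁ : AnalyticOnNhd ℂ W₁ {Y : S₁ → 𝔸 | ‖Y‖ < a₃₁})
    (Hm₁ : (T₁ → 𝔸) →L[ℂ] (S₁ → 𝔸)) {B₀'₁ : ℝ} (hB₀'₁ : 0 ≤ B₀'₁) (hH46₁ : ∀ X, ‖Hm₁ X‖ ≤ B₀'₁ * ‖X‖)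
    {c1h₁ ε₃₁ : ℝ} (hc1h₁ : 1 ≤ c1h₁) (hε₃₁ : 0 < ε₃₁)
    (h18₁ : 18 * ((8 * (131072 * ((d : ℝ) + 1) ^ 2) * Real.exp (4 * (800 * ((d : ℝ) + 1) ^ 2 * ((d : ℝ) + 4)) * α₁)) *
      ((L : ℝ) ^ h) ^ 2) * B₀'₁ * d * c1h₁ * ε₃₁ ≤ 1) (h2₁ : 2 * ε₃₁ ≤ b₁ / 2) (hnest₁ : ε₄₁ + 𝔞₁ ≤ ε₃₁)
    {δ₀₁ Bk₁ : ℝ} (hδ₀₁ : 0 < δ₀₁) (hBk₁ : 0 ≤ Bk₁)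
    (hHker₁ : ∀ (c'' : T₁) (Y : 𝔸) (s : S₁), ‖Hm₁ (Pi.single c'' Y) s‖ ≤
      Bk₁ * Real.exp (-(δ₀₁ * ((B7Prop1Explicit.l1 (loK L h c''.1.1 - s.1.1) : ℝ) / (L : ℝ) ^ h))) * ‖Y‖)
    (hq₁ : (C3Gen d L * (((L : ℝ) ^ h) ^ 2 * (2 * ε₃₁)) * (2 * d) * Bk₁ * Real.exp (2 * d * δ₀₁)) * (d * B6.c0 δ₀₁ (1 / 2) ^ d) < 1)
    {Tm₁ : (S₁ → 𝔸) → (S₁ → 𝔸)}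
    (hTm₁ : Tm₁ = fun Y : S₁ → 𝔸 => Y - Hm₁ (Dfix (B11Eq44Concrete.Cmap L U₁ S₁ T₁ h) (Hm₁ : (T₁ → 𝔸) →ₗ[ℂ] (S₁ → 𝔸))
      ((8 * (131072 * ((d : ℝ) + 1) ^ 2) * Real.exp (4 * (800 * ((d : ℝ) + 1) ^ 2 * ((d : ℝ) + 4)) * α₁)) * ((L : ℝ) ^ h) ^ 2) Y))
    -- scheme 2: the same letters at the concrete `C_h(U₂, ·)`
    (Reg₂ : Regime 𝒢₂ 0 W₂ B₀₂ θ₂ C₄₂ a₃₂ 𝔧₂ 𝔞₂ ε₄₂) (hWa₂ : AnalyticOnNhd ℂ W₂ {Y : S₂ → 𝔸 | ‖Y‖ < a₃₂})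
    (Hm₂ : (T₂ → 𝔸) →L[ℂ] (S₂ → 𝔸)) {B₀'₂ : ℝ} (hB₀'₂ : 0 ≤ B₀'₂) (hH46₂ : ∀ X, ‖Hm₂ X‖ ≤ B₀'₂ * ‖X‖)
    {c1h₂ ε₃₂ : ℝ} (hc1h₂ : 1 ≤ c1h₂) (hε₃₂ : 0 < ε₃₂)
    (h18₂ : 18 * ((8 * (131072 * ((d : ℝ) + 1) ^ 2) * Real.exp (4 * (800 * ((d : ℝ) + 1) ^ 2 * ((d : ℝ) + 4)) * α₂)) *
      ((L : ℝ) ^ h) ^ 2) * B₀'₂ * d * c1h₂ * ε₃₂ ≤ 1) (h2₂ : 2 * ε₃₂ ≤ b₂ / 2) (hnest₂ : ε₄₂ + 𝔞₂ ≤ ε₃₂)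
    {δ₀₂ Bk₂ : ℝ} (hδ₀₂ : 0 < δ₀₂) (hBk₂ : 0 ≤ Bk₂)
    (hHker₂ : ∀ (c'' : T₂) (Y : 𝔸) (s : S₂), ‖Hm₂ (Pi.single c'' Y) s‖ ≤
      Bk₂ * Real.exp (-(δ₀₂ * ((B7Prop1Explicit.l1 (loK L h c''.1.1 - s.1.1) : ℝ) / (L : ℝ) ^ h))) * ‖Y‖)
    (hq₂ : (C3Gen d L * (((L : ℝ) ^ h) ^ 2 * (2 * ε₃₂)) * (2 * d) * Bk₂ * Real.exp (2 * d * δ₀₂)) * (d * B6.c0 δ₀₂ (1 / 2) ^ d) < 1)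
    {Tm₂ : (S₂ → 𝔸) → (S₂ → 𝔸)}
    (hTm₂ : Tm₂ = fun Y : S₂ → 𝔸 => Y - Hm₂ (Dfix (B11Eq44Concrete.Cmap L U₂ S₂ T₂ h) (Hm₂ : (T₂ → 𝔸) →ₗ[ℂ] (S₂ → 𝔸))
      ((8 * (131072 * ((d : ℝ) + 1) ^ 2) * Real.exp (4 * (800 * ((d : ℝ) + 1) ^ 2 * ((d : ℝ) + 4)) * α₂)) * ((L : ℝ) ^ h) ^ 2) Y))
    -- chain 1's argument field: p29's two-field layer tower on the coarse bonds `T₁`, `h` levels, in the domain of (180) of scheme 1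
    (dep : T₁ → ℕ) (pt : T₁ → B7Prop1Explicit.Site d) (dir : T₁ → Fin d) {k j : ℕ} (hhk : h ≤ k)
    (U₀' U' : B7Prop1Explicit.Site d → Fin d → 𝔸ˣ) (hU₀' : ∀ x κ, U₀' x κ ∈ G) (hU' : ∀ x κ, U' x κ ∈ G)
    {Bf : T₁ → 𝔸}
    (hBf : Bf = fun i => mlog (((avgIter L U' (h - dep i) (pt i) (dir i) *
      (avgIter L U₀' (h - dep i) (pt i) (dir i))⁻¹ : 𝔸ˣ) : 𝔸)))
    (hdom₁ : ‖H₀₁ Bf‖ < 𝔞₁ ∧ ‖D2₁ (H₀₁ Bf)‖ < 𝔧₁)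
    -- chain 2's argument field `B′` on the coarse bonds `T₂` under (1.82), in the domain of (180) of scheme 2
    {δ'k : ℝ} (B' : T₂ → 𝔸) (hB' : ∀ i, ‖B' i‖ ≤ δ'k) (hdom₂ : ‖H₀₂ B'‖ < 𝔞₂ ∧ ‖D2₂ (H₀₂ B')‖ < 𝔧₂)
    -- the two output presentations on the two cube geometries; backgrounds `Cc = C` (chain 1) and `C₀` (chain 2)
    (box₁ : (cubeGeometry L h S₁ T₁).Site → Finset (B7Prop1Explicit.Site d))
    (blk₁ : B7Prop1Explicit.Site d → (cubeGeometry L h S₁ T₁).Site) (y₀₁ : (cubeGeometry L h S₁ T₁).Site)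
    (Sc₁ : (cubeGeometry L h S₁ T₁).Site → Finset (B7Prop1Explicit.Site d × Fin d × Fin d))
    (box₂ : (cubeGeometry L h S₂ T₂).Site → Finset (B7Prop1Explicit.Site d))
    (blk₂ : B7Prop1Explicit.Site d → (cubeGeometry L h S₂ T₂).Site) (y₀₂ : (cubeGeometry L h S₂ T₂).Site)
    (Sc₂ : (cubeGeometry L h S₂ T₂).Site → Finset (B7Prop1Explicit.Site d × Fin d × Fin d))
    {ξ : ℝ} {Cc C₀ : B7Prop1Explicit.Site d → Fin d → 𝔸ˣ}
    (ev₁ : B7Prop1Explicit.Site d → ((S₁ → 𝔸) →L[ℝ] (Fin d → 𝔸))) {b3₁ : BlockNorm (cubeGeometry L h S₁ T₁) 𝒵₁}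
    (hev₁₀ : ∀ (y : (cubeGeometry L h S₁ T₁).Site) (v : S₁ → 𝔸), ∀ x ∈ box₁ y, ‖ev₁ x v‖ ≤
      (supSize (cubeGeometry L h S₁ T₁) (boxS L h S₁ T₁) (blkS L h S₁ T₁) : BlockNorm (cubeGeometry L h S₁ T₁) (S₁ → 𝔸)).loc y v)
    (hev₁₁ : ∀ (y : (cubeGeometry L h S₁ T₁).Site) (v : S₁ → 𝔸),
      (covDerivBlockSize (cubeGeometry L h S₁ T₁) y₀₁ Sc₁ ξ Cc).loc y (fun x => ev₁ x v) ≤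
        (supSize (cubeGeometry L h S₁ T₁) (boxS L h S₁ T₁) (blkS L h S₁ T₁) : BlockNorm (cubeGeometry L h S₁ T₁) (S₁ → 𝔸)).loc y v)
    (ev₂ : B7Prop1Explicit.Site d → ((S₂ → 𝔸) →L[ℝ] (Fin d → 𝔸))) {b3₂ : BlockNorm (cubeGeometry L h S₂ T₂) 𝒵₂}
    (hev₂₀ : ∀ (y : (cubeGeometry L h S₂ T₂).Site) (v : S₂ → 𝔸), ∀ x ∈ box₂ y, ‖ev₂ x v‖ ≤
      (supSize (cubeGeometry L h S₂ T₂) (boxS L h S₂ T₂) (blkS L h S₂ T₂) : BlockNorm (cubeGeometry L h S₂ T₂) (S₂ → 𝔸)).loc y v)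
    (hev₂₁ : ∀ (y : (cubeGeometry L h S₂ T₂).Site) (v : S₂ → 𝔸),
      (covDerivBlockSize (cubeGeometry L h S₂ T₂) y₀₂ Sc₂ ξ C₀).loc y (fun x => ev₂ x v) ≤
        (supSize (cubeGeometry L h S₂ T₂) (boxS L h S₂ T₂) (blkS L h S₂ T₂) : BlockNorm (cubeGeometry L h S₂ T₂) (S₂ → 𝔸)).loc y v)
    -- the abstract majorant letters of Sect. G, scheme 1
    {BG₁ θW₁ cΔ₁ A₀₁ AH₁ : ℝ} (hBG₁ : 0 ≤ BG₁) (hθW₁ : 0 ≤ θW₁) (hcΔ₁ : 0 ≤ cΔ₁) (hA₀₁ : 0 ≤ A₀₁) (hAH₁ : 0 ≤ AH₁)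
    (hG190₁ : HasMaj b3₁ (supSize (cubeGeometry L h S₁ T₁) (boxS L h S₁ T₁) (blkS L h S₁ T₁) :
        BlockNorm (cubeGeometry L h S₁ T₁) (S₁ → 𝔸))
      (𝒢₁.restrictScalars ℝ : 𝒵₁ →ₗ[ℝ] (S₁ → 𝔸)) (fun y y' => BG₁ * Real.exp (-(δ₀₁ * (cubeGeometry L h S₁ T₁).dist y y'))))
    (hD2H0₁ : HasMaj (supSize (cubeGeometry L h S₁ T₁) (boxT L h S₁ T₁) (blkT L h S₁ T₁) :
        BlockNorm (cubeGeometry L h S₁ T₁) (T₁ → 𝔸)) b3₁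
      ((D2₁ ∘L H₀₁).restrictScalars ℝ : (T₁ → 𝔸) →ₗ[ℝ] 𝒵₁) (fun y y' => cΔ₁ * Real.exp (-(δ₀₁ * (cubeGeometry L h S₁ T₁).dist y y'))))
    (hH0₁ : HasMaj (supSize (cubeGeometry L h S₁ T₁) (boxT L h S₁ T₁) (blkT L h S₁ T₁) :
        BlockNorm (cubeGeometry L h S₁ T₁) (T₁ → 𝔸))
      (supSize (cubeGeometry L h S₁ T₁) (boxS L h S₁ T₁) (blkS L h S₁ T₁) : BlockNorm (cubeGeometry L h S₁ T₁) (S₁ → 𝔸))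
      (H₀₁.restrictScalars ℝ : (T₁ → 𝔸) →ₗ[ℝ] (S₁ → 𝔸)) (fun y y' => A₀₁ * Real.exp (-(δ₀₁ * (cubeGeometry L h S₁ T₁).dist y y'))))
    (hH₁ : HasMaj (supSize (cubeGeometry L h S₁ T₁) (boxT L h S₁ T₁) (blkT L h S₁ T₁) :
        BlockNorm (cubeGeometry L h S₁ T₁) (T₁ → 𝔸))
      (supSize (cubeGeometry L h S₁ T₁) (boxS L h S₁ T₁) (blkS L h S₁ T₁) : BlockNorm (cubeGeometry L h S₁ T₁) (S₁ → 𝔸))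
      (Hm₁.restrictScalars ℝ : (T₁ → 𝔸) →ₗ[ℝ] (S₁ → 𝔸)) (fun y y' => AH₁ * Real.exp (-(δ₀₁ / 2 * (cubeGeometry L h S₁ T₁).dist y y'))))
    (h189₁ : ∀ B'' : T₁ → 𝔸, ‖H₀₁ B''‖ < 𝔞₁ → ‖D2₁ (H₀₁ B'')‖ < 𝔧₁ →
      Ineq189 (supSize (cubeGeometry L h S₁ T₁) (boxS L h S₁ T₁) (blkS L h S₁ T₁) : BlockNorm (cubeGeometry L h S₁ T₁) (S₁ → 𝔸))
        b3₁ ((fderiv ℂ W₁ (solA180 𝒢₁ W₁ D2₁ H₀₁ ε₄₁ B'' + H₀₁ B'')).restrictScalars ℝ : (S₁ → 𝔸) →ₗ[ℝ] 𝒵₁) θW₁ δ₀₁)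
    (hqG₁ : qG b3₁.κ 1 BG₁ θW₁ (B6.c0 δ₀₁ (1 / 8) ^ d) < 1)
    -- the abstract majorant letters of Sect. G, scheme 2
    {BG₂ θW₂ cΔ₂ A₀₂ AH₂ : ℝ} (hBG₂ : 0 ≤ BG₂) (hθW₂ : 0 ≤ θW₂) (hcΔ₂ : 0 ≤ cΔ₂) (hA₀₂ : 0 ≤ A₀₂) (hAH₂ : 0 ≤ AH₂)
    (hG190₂ : HasMaj b3₂ (supSize (cubeGeometry L h S₂ T₂) (boxS L h S₂ T₂) (blkS L h S₂ T₂) :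
        BlockNorm (cubeGeometry L h S₂ T₂) (S₂ → 𝔸))
      (𝒢₂.restrictScalars ℝ : 𝒵₂ →ₗ[ℝ] (S₂ → 𝔸)) (fun y y' => BG₂ * Real.exp (-(δ₀₂ * (cubeGeometry L h S₂ T₂).dist y y'))))
    (hD2H0₂ : HasMaj (supSize (cubeGeometry L h S₂ T₂) (boxT L h S₂ T₂) (blkT L h S₂ T₂) :
        BlockNorm (cubeGeometry L h S₂ T₂) (T₂ → 𝔸)) b3₂
      ((D2₂ ∘L H₀₂).restrictScalars ℝ : (T₂ → 𝔸) →ₗ[ℝ] 𝒵₂) (fun y y' => cΔ₂ * Real.exp (-(δ₀₂ * (cubeGeometry L h S₂ T₂).dist y y'))))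
    (hH0₂ : HasMaj (supSize (cubeGeometry L h S₂ T₂) (boxT L h S₂ T₂) (blkT L h S₂ T₂) :
        BlockNorm (cubeGeometry L h S₂ T₂) (T₂ → 𝔸))
      (supSize (cubeGeometry L h S₂ T₂) (boxS L h S₂ T₂) (blkS L h S₂ T₂) : BlockNorm (cubeGeometry L h S₂ T₂) (S₂ → 𝔸))
      (H₀₂.restrictScalars ℝ : (T₂ → 𝔸) →ₗ[ℝ] (S₂ → 𝔸)) (fun y y' => A₀₂ * Real.exp (-(δ₀₂ * (cubeGeometry L h S₂ T₂).dist y y'))))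
    (hH₂ : HasMaj (supSize (cubeGeometry L h S₂ T₂) (boxT L h S₂ T₂) (blkT L h S₂ T₂) :
        BlockNorm (cubeGeometry L h S₂ T₂) (T₂ → 𝔸))
      (supSize (cubeGeometry L h S₂ T₂) (boxS L h S₂ T₂) (blkS L h S₂ T₂) : BlockNorm (cubeGeometry L h S₂ T₂) (S₂ → 𝔸))
      (Hm₂.restrictScalars ℝ : (T₂ → 𝔸) →ₗ[ℝ] (S₂ → 𝔸)) (fun y y' => AH₂ * Real.exp (-(δ₀₂ / 2 * (cubeGeometry L h S₂ T₂).dist y y'))))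
    (h189₂ : ∀ B'' : T₂ → 𝔸, ‖H₀₂ B''‖ < 𝔞₂ → ‖D2₂ (H₀₂ B'')‖ < 𝔧₂ →
      Ineq189 (supSize (cubeGeometry L h S₂ T₂) (boxS L h S₂ T₂) (blkS L h S₂ T₂) : BlockNorm (cubeGeometry L h S₂ T₂) (S₂ → 𝔸))
        b3₂ ((fderiv ℂ W₂ (solA180 𝒢₂ W₂ D2₂ H₀₂ ε₄₂ B'' + H₀₂ B'')).restrictScalars ℝ : (S₂ → 𝔸) →ₗ[ℝ] 𝒵₂) θW₂ δ₀₂)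
    (hqG₂ : qG b3₂.κ 1 BG₂ θW₂ (B6.c0 δ₀₂ (1 / 8) ^ d) < 1)
    -- the [IV] side: the letters of §1 minus the eight located hypotheses, `hdist₁,₂` and `hrow₁,₂`; the two knit row-sum rates
    -- `σᵢ = aᵢδ₀ᵢ` (`a₁δ₀₁ + τ ≤ ⅛δ₀₁`, `a₂δ₀₂ ≤ ⅛δ₀₂`)
    {τ D₁ B₃ δ M M₁ εh εj εk γ gh β₀ α' rk rj s a₁ a₂ : ℝ} {r R : ℕ}
    (ha₁ : 0 < a₁) (hτ : 0 ≤ τ) (haτ₁ : a₁ * δ₀₁ + τ ≤ δ₀₁ / 8) (y₁ : (cubeGeometry L h S₁ T₁).Site)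
    (ha₂ : 0 < a₂) (ha₂8 : a₂ * δ₀₂ ≤ δ₀₂ / 8) (y₂ : (cubeGeometry L h S₂ T₂).Site)
    {Cw Xc rr : ℝ} (hε : 0 < εh) (hCw : 0 ≤ Cw) (hδ0 : 0 ≤ δ'k) (lo hi : B7Prop1Explicit.Site d) (hlohi : lo ≤ hi)
    (h96 : pdevOn (tlo L lo h) (thi L hi h) U' < 3 / 4 * εh * (((L : ℝ) ^ h)⁻¹) ^ 2)
    (h80 : pdevOn (tlo L lo h) (thi L hi h) U₀' < Cw * εk * (((L : ℝ) ^ k)⁻¹) ^ 2)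
    (hD : εk ≤ (1 + β₀) * Real.sqrt (k - h : ℕ) * εh)
    (hXc : Xc = (((L : ℝ) ^ (k - h)) ^ 2)⁻¹ * Real.sqrt (k - h : ℕ) * Cw * (1 + β₀)) (hX1 : Xc ≤ 1)
    (hδr : δ'k ≤ (1 + β₀) * Real.sqrt (k - h : ℕ) * rr * εh)
    (hsmall : 2 * (1 + β₀) * Real.sqrt (k - h : ℕ) * rr < (d : ℝ) ^ 2)
    (hs3 : C0 d * εh ≤ 1 / 3) (hs2 : 2 * εh ≤ c2' d L) (hs6 : 11 * (d : ℝ) ^ 2 * εh + δ'k ≤ 1 / 6)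
    (h19 : ∀ n, n < h → ∀ z, tlo L lo n ≤ z → z ≤ thi L hi n → ∀ r : Fin d → Fin L,
      axialFn (avgIter L U' (h - (n + 1))) ((L : ℤ) • z) ((L : ℤ) • z + boxVec L r) =
        axialFn (avgIter L U₀' (h - (n + 1))) ((L : ℤ) • z) ((L : ℤ) • z + boxVec L r))
    (h82 : ∀ x ν, lo ≤ x → x + e ν ≤ hi →
      ‖((avgIter L U' h x ν * (avgIter L U₀' h x ν)⁻¹ : 𝔸ˣ) : 𝔸) - 1‖ ≤ δ'k)
    (hX : ∀ i, dep i ≤ h ∧ tlo L lo (dep i) ≤ pt i ∧ pt i + e (dir i) ≤ thi L hi (dep i))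
    (hfar₁ : ∀ y' i, i ∈ boxT L h S₁ T₁ y' → D₁ ≤ (cubeGeometry L h S₁ T₁).dist y₁ y')
    (hξ : 0 < ξ) (hCc : ∀ z κ, Cc z κ ∈ U1 𝔸)
    {Hf₁ : B7Prop1Explicit.Site d → Fin d → 𝔸}
    (hHf₁ : Hf₁ = fun x => ev₁ x (chartH179 𝒢₁ W₁ D2₁ H₀₁ Tm₁ ε₄₁ Bf))
    (hH₁sa : ∀ z κ, IsSelfAdjoint (Hf₁ z κ))
    {g₁ : B7Prop1Explicit.Site d → 𝔸ˣ} (hg₁ : ∀ z, g₁ z ∈ U1 𝔸)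
    (hC₀ : ∀ z κ, C₀ z κ ∈ U1 𝔸)
    {Hf₂ : B7Prop1Explicit.Site d → Fin d → 𝔸}
    (hHf₂ : Hf₂ = fun x => ev₂ x (chartH179 𝒢₂ W₂ D2₂ H₀₂ Tm₂ ε₄₂ B'))
    (hH₂sa : ∀ z κ, IsSelfAdjoint (Hf₂ z κ))
    {g₂ : B7Prop1Explicit.Site d → 𝔸ˣ} (hg₂ : ∀ z, g₂ z ∈ U1 𝔸)
    (hrep : Cc = gaugeAct g₂ (B8Lemma1NonAbelian.mulCfg (B8Eq146AExpansion.expCfg (B8Eq146AExpansion.iEta ξ Hf₂)) C₀))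
    (μ ν : Fin d) (x : B7Prop1Explicit.Site d) {Linv η B₅ dist Cst Lkj : ℝ}
    (hgeom₁ : δ * (M / M₁) * ((j - h : ℕ) : ℝ) + δ * M / 2 * (R : ℝ) ≤ τ * D₁)
    (hCB₁ : const190 1 1 b3₁.κ BG₁ θW₁ cΔ₁ A₀₁ AH₁
        (d * Real.exp (1 / 2 * d * δ₀₁) *
          ((1 - (C3Gen d L * (((L : ℝ) ^ h) ^ 2 * (2 * ε₃₁)) * (2 * d) * Bk₁ * Real.exp (2 * d * δ₀₁)) *
              (d * B6.c0 δ₀₁ (1 / 2) ^ d))⁻¹ * (Real.exp (d * δ₀₁) * (C3Gen d L * ((L : ℝ) ^ h) ^ 2 * (2 * ε₃₁)))))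
        (B6.c0 δ₀₁ (1 / 8) ^ d) * B6.c0 δ₀₁ a₁ ^ d ≤ B₃)
    (hCB₂ : const190 1 1 b3₂.κ BG₂ θW₂ cΔ₂ A₀₂ AH₂
        (d * Real.exp (1 / 2 * d * δ₀₂) *
          ((1 - (C3Gen d L * (((L : ℝ) ^ h) ^ 2 * (2 * ε₃₂)) * (2 * d) * Bk₂ * Real.exp (2 * d * δ₀₂)) *
              (d * B6.c0 δ₀₂ (1 / 2) ^ d))⁻¹ * (Real.exp (d * δ₀₂) * (C3Gen d L * ((L : ℝ) ^ h) ^ 2 * (2 * ε₃₂)))))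
        (B6.c0 δ₀₂ (1 / 8) ^ d) * B6.c0 δ₀₂ a₂ ^ d ≤ B₃)
    (hB₃ : 0 < B₃) (hδM : 1 ≤ δ * (M / M₁)) (hδM2 : 1 ≤ δ * M / 2) (hεj : 0 < εj)
    (hflowB : εh ≤ (1 + β₀) ^ 2 * (1 + ((j - h : ℕ) : ℝ) ^ β₀) * εj) (hβ₀ : 0 < β₀) (hβ₁ : β₀ ≤ 1)
    (hr : 1 ≤ r) (hR : B14.IsRj L r gh R) (hgh : 0 < gh) (hgγ : gh ≤ γ) (hγe : 1 ≤ Real.log (γ ^ 2)⁻¹)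
    (hγB : 23 * (d : ℝ) ^ 2 * B₃ * (1 + β₀) ^ 2 * γ ^ 2 < α')
    (hεk : 0 ≤ εk) (hrj : 0 ≤ rj) (hs0 : 0 ≤ s) (hδ'k : δ'k ≤ rk * εk) (hrk : rk ≤ rj)
    (hflowC : εk ≤ (1 + β₀) * (1 + s) * εj) (hγC : B₃ * (1 + β₀) * (1 + s) * rj < α')
    (hx₁ : x ∈ box₁ y₁) (hxμ₁ : x + e μ ∈ box₁ y₁) (hxν₁ : x + e ν ∈ box₁ y₁)
    (hS₁₁ : (x, μ, ν) ∈ Sc₁ y₁) (hS₂₁ : (x, ν, μ) ∈ Sc₁ y₁)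
    (hx₂ : x ∈ box₂ y₂) (hxμ₂ : x + e μ ∈ box₂ y₂) (hxν₂ : x + e ν ∈ box₂ y₂)
    (hS₁₂ : (x, μ, ν) ∈ Sc₂ y₂) (hS₂₂ : (x, ν, μ) ∈ Sc₂ y₂)
    (h180 : B15.Ineq180 ‖B8Ineq132.plaqF C₀ μ ν x - 1‖ εk η B₃ B₅ M δ dist Cst)
    (hα' : 2 * α' ≤ 1 / 8) (hL0 : 0 ≤ Linv) (hL1 : Linv ≤ 1) (hε1 : εj ≤ 1 / 10)
    (hXst : 0 ≤ Cst * B₃ * B₅ * M ^ 5 * Real.exp (-δ * dist)) (he : 0 ≤ εk * η ^ 2)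
    (hscale : εk * η ^ 2 ≤ Lkj * (εj * ξ ^ 2)) (hLkj1 : Lkj ≤ 1) :
    ‖B8Ineq132.plaqF (gaugeAct g₁ (B8Lemma1NonAbelian.mulCfg (B8Eq146AExpansion.expCfg
        (B8Eq146AExpansion.iEta ξ Hf₁)) Cc)) μ ν x - 1‖
      < (2 * Lkj + 4 * (2 * α') + Cst * (1 + Linv * (2 * α') * εj) ^ 2 * B₃ * B₅ * M ^ 5 * Real.exp (-δ * dist) * Lkj)
        * (εj * ξ ^ 2) := by
  subst hTm₁ hTm₂ hBf
  -- scheme 1: the sup pair (r08) and the covariant pair (r12) at the concrete `C_h(U₁, ·)` on `cubeGeometry L h S₁ T₁`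
  obtain ⟨h190₁₀, hmv₁₀⟩ := ineq190_and_hmv_supSize_concreteC_kernel L hL hAG k₁ U₁ hU₁ hα₁ hα₁3 hα₁4 h52₁ hb₁ hsmall₁ hc₃₁
    h145₁ h155₁ S₁ T₁ hh₁ hd1 Reg₁ hWa₁ Hm₁ hB₀'₁ hH46₁ hc1h₁ hε₃₁ h18₁ h2₁ hnest₁ hδ₀₁ hBk₁ hHker₁ hq₁ hdom₁ ev₁ hev₁₀ hBG₁
    hθW₁ hcΔ₁ hA₀₁ hAH₁ hG190₁ hD2H0₁ hH0₁ hH₁ h189₁ hqG₁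
    (fun B'' => fun x => ev₁ x (chartH179 𝒢₁ W₁ D2₁ H₀₁
      (fun Y : S₁ → 𝔸 => Y - Hm₁ (Dfix (B11Eq44Concrete.Cmap L U₁ S₁ T₁ h) (Hm₁ : (T₁ → 𝔸) →ₗ[ℂ] (S₁ → 𝔸))
        ((8 * (131072 * ((d : ℝ) + 1) ^ 2) * Real.exp (4 * (800 * ((d : ℝ) + 1) ^ 2 * ((d : ℝ) + 4)) * α₁)) *
          ((L : ℝ) ^ h) ^ 2) Y)) ε₄₁ B''))
    (fun t => (LinearMap.pi fun x => ((ev₁ x : (S₁ → 𝔸) →L[ℝ] (Fin d → 𝔸)) : (S₁ → 𝔸) →ₗ[ℝ] (Fin d → 𝔸))) ∘ₗ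
      ((fderiv ℂ (chartH179 𝒢₁ W₁ D2₁ H₀₁
        (fun Y : S₁ → 𝔸 => Y - Hm₁ (Dfix (B11Eq44Concrete.Cmap L U₁ S₁ T₁ h) (Hm₁ : (T₁ → 𝔸) →ₗ[ℂ] (S₁ → 𝔸))
          ((8 * (131072 * ((d : ℝ) + 1) ^ 2) * Real.exp (4 * (800 * ((d : ℝ) + 1) ^ 2 * ((d : ℝ) + 4)) * α₁)) *
            ((L : ℝ) ^ h) ^ 2) Y)) ε₄₁)
        ((t : ℝ) • (fun i => mlog (((avgIter L U' (h - dep i) (pt i) (dir i) *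
          (avgIter L U₀' (h - dep i) (pt i) (dir i))⁻¹ : 𝔸ˣ) : 𝔸))))).restrictScalars ℝ :
            (T₁ → 𝔸) →ₗ[ℝ] (S₁ → 𝔸)))
    (fun _ => rfl) (fun _ => rfl) y₁
  obtain ⟨h190₁₁, hmv₁₁⟩ := B11Ineq190DerivConcreteC.ineq190_and_hmv_covDerivBlockSize_concreteC_kernel L hL hAG k₁ U₁ hU₁ hα₁
    hα₁3 hα₁4 h52₁ hb₁ hsmall₁ hc₃₁ h145₁ h155₁ S₁ T₁ hh₁ hd1 Reg₁ hWa₁ Hm₁ hB₀'₁ hH46₁ hc1h₁ hε₃₁ h18₁ h2₁ hnest₁ hδ₀₁ hBk₁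
    hHker₁ hq₁ hdom₁ y₀₁ Sc₁ ev₁ hev₁₁ hBG₁ hθW₁ hcΔ₁ hA₀₁ hAH₁ hG190₁ hD2H0₁ hH0₁ hH₁ h189₁ hqG₁
    (fun B'' => fun x => ev₁ x (chartH179 𝒢₁ W₁ D2₁ H₀₁
      (fun Y : S₁ → 𝔸 => Y - Hm₁ (Dfix (B11Eq44Concrete.Cmap L U₁ S₁ T₁ h) (Hm₁ : (T₁ → 𝔸) →ₗ[ℂ] (S₁ → 𝔸))
        ((8 * (131072 * ((d : ℝ) + 1) ^ 2) * Real.exp (4 * (800 * ((d : ℝ) + 1) ^ 2 * ((d : ℝ) + 4)) * α₁)) *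
          ((L : ℝ) ^ h) ^ 2) Y)) ε₄₁ B''))
    (fun t => (LinearMap.pi fun x => ((ev₁ x : (S₁ → 𝔸) →L[ℝ] (Fin d → 𝔸)) : (S₁ → 𝔸) →ₗ[ℝ] (Fin d → 𝔸))) ∘ₗ
      ((fderiv ℂ (chartH179 𝒢₁ W₁ D2₁ H₀₁
        (fun Y : S₁ → 𝔸 => Y - Hm₁ (Dfix (B11Eq44Concrete.Cmap L U₁ S₁ T₁ h) (Hm₁ : (T₁ → 𝔸) →ₗ[ℂ] (S₁ → 𝔸))
          ((8 * (131072 * ((d : ℝ) + 1) ^ 2) * Real.exp (4 * (800 * ((d : ℝ) + 1) ^ 2 * ((d : ℝ) + 4)) * α₁)) *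
            ((L : ℝ) ^ h) ^ 2) Y)) ε₄₁)
        ((t : ℝ) • (fun i => mlog (((avgIter L U' (h - dep i) (pt i) (dir i) *
          (avgIter L U₀' (h - dep i) (pt i) (dir i))⁻¹ : 𝔸ˣ) : 𝔸))))).restrictScalars ℝ :
            (T₁ → 𝔸) →ₗ[ℝ] (S₁ → 𝔸)))
    (fun _ => rfl) (fun _ => rfl) y₁
  -- scheme 2: the two pairs at the concrete `C_h(U₂, ·)` on `cubeGeometry L h S₂ T₂`, argument field `B′`
  obtain ⟨h190₂₀, hmv₂₀⟩ := ineq190_and_hmv_supSize_concreteC_kernel L hL hAG k₂ U₂ hU₂ hα₂ hα₂3 hα₂4 h52₂ hb₂ hsmall₂ hc₃₂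
    h145₂ h155₂ S₂ T₂ hh₂ hd1 Reg₂ hWa₂ Hm₂ hB₀'₂ hH46₂ hc1h₂ hε₃₂ h18₂ h2₂ hnest₂ hδ₀₂ hBk₂ hHker₂ hq₂ hdom₂ ev₂ hev₂₀ hBG₂
    hθW₂ hcΔ₂ hA₀₂ hAH₂ hG190₂ hD2H0₂ hH0₂ hH₂ h189₂ hqG₂
    (fun B'' => fun x => ev₂ x (chartH179 𝒢₂ W₂ D2₂ H₀₂
      (fun Y : S₂ → 𝔸 => Y - Hm₂ (Dfix (B11Eq44Concrete.Cmap L U₂ S₂ T₂ h) (Hm₂ : (T₂ → 𝔸) →ₗ[ℂ] (S₂ → 𝔸))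
        ((8 * (131072 * ((d : ℝ) + 1) ^ 2) * Real.exp (4 * (800 * ((d : ℝ) + 1) ^ 2 * ((d : ℝ) + 4)) * α₂)) *
          ((L : ℝ) ^ h) ^ 2) Y)) ε₄₂ B''))
    (fun t => (LinearMap.pi fun x => ((ev₂ x : (S₂ → 𝔸) →L[ℝ] (Fin d → 𝔸)) : (S₂ → 𝔸) →ₗ[ℝ] (Fin d → 𝔸))) ∘ₗ
      ((fderiv ℂ (chartH179 𝒢₂ W₂ D2₂ H₀₂
        (fun Y : S₂ → 𝔸 => Y - Hm₂ (Dfix (B11Eq44Concrete.Cmap L U₂ S₂ T₂ h) (Hm₂ : (T₂ → 𝔸) →ₗ[ℂ] (S₂ → 𝔸))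
          ((8 * (131072 * ((d : ℝ) + 1) ^ 2) * Real.exp (4 * (800 * ((d : ℝ) + 1) ^ 2 * ((d : ℝ) + 4)) * α₂)) *
            ((L : ℝ) ^ h) ^ 2) Y)) ε₄₂)
        ((t : ℝ) • B')).restrictScalars ℝ : (T₂ → 𝔸) →ₗ[ℝ] (S₂ → 𝔸)))
    (fun _ => rfl) (fun _ => rfl) y₂
  obtain ⟨h190₂₁, hmv₂₁⟩ := B11Ineq190DerivConcreteC.ineq190_and_hmv_covDerivBlockSize_concreteC_kernel L hL hAG k₂ U₂ hU₂ hα₂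
    hα₂3 hα₂4 h52₂ hb₂ hsmall₂ hc₃₂ h145₂ h155₂ S₂ T₂ hh₂ hd1 Reg₂ hWa₂ Hm₂ hB₀'₂ hH46₂ hc1h₂ hε₃₂ h18₂ h2₂ hnest₂ hδ₀₂ hBk₂
    hHker₂ hq₂ hdom₂ y₀₂ Sc₂ ev₂ hev₂₁ hBG₂ hθW₂ hcΔ₂ hA₀₂ hAH₂ hG190₂ hD2H0₂ hH0₂ hH₂ h189₂ hqG₂
    (fun B'' => fun x => ev₂ x (chartH179 𝒢₂ W₂ D2₂ H₀₂
      (fun Y : S₂ → 𝔸 => Y - Hm₂ (Dfix (B11Eq44Concrete.Cmap L U₂ S₂ T₂ h) (Hm₂ : (T₂ → 𝔸) →ₗ[ℂ] (S₂ → 𝔸))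
        ((8 * (131072 * ((d : ℝ) + 1) ^ 2) * Real.exp (4 * (800 * ((d : ℝ) + 1) ^ 2 * ((d : ℝ) + 4)) * α₂)) *
          ((L : ℝ) ^ h) ^ 2) Y)) ε₄₂ B''))
    (fun t => (LinearMap.pi fun x => ((ev₂ x : (S₂ → 𝔸) →L[ℝ] (Fin d → 𝔸)) : (S₂ → 𝔸) →ₗ[ℝ] (Fin d → 𝔸))) ∘ₗ
      ((fderiv ℂ (chartH179 𝒢₂ W₂ D2₂ H₀₂
        (fun Y : S₂ → 𝔸 => Y - Hm₂ (Dfix (B11Eq44Concrete.Cmap L U₂ S₂ T₂ h) (Hm₂ : (T₂ → 𝔸) →ₗ[ℂ] (S₂ → 𝔸))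
          ((8 * (131072 * ((d : ℝ) + 1) ^ 2) * Real.exp (4 * (800 * ((d : ℝ) + 1) ^ 2 * ((d : ℝ) + 4)) * α₂)) *
            ((L : ℝ) ^ h) ^ 2) Y)) ε₄₂)
        ((t : ℝ) • B')).restrictScalars ℝ : (T₂ → 𝔸) →ₗ[ℝ] (S₂ → 𝔸)))
    (fun _ => rfl) (fun _ => rfl) y₂
  -- bookkeeping: the two (190) constants are `≥ 0`; the knit's two row sums on the cube geometries
  have hKc₁ : 0 ≤ const190 1 1 b3₁.κ BG₁ θW₁ cΔ₁ A₀₁ AH₁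
      (d * Real.exp (1 / 2 * d * δ₀₁) *
        ((1 - (C3Gen d L * (((L : ℝ) ^ h) ^ 2 * (2 * ε₃₁)) * (2 * d) * Bk₁ * Real.exp (2 * d * δ₀₁)) *
            (d * B6.c0 δ₀₁ (1 / 2) ^ d))⁻¹ * (Real.exp (d * δ₀₁) * (C3Gen d L * ((L : ℝ) ^ h) ^ 2 * (2 * ε₃₁)))))
      (B6.c0 δ₀₁ (1 / 8) ^ d) :=
    const190_nonneg' zero_le_one zero_le_one b3₁.κ_nonneg (c0_pow_nonneg δ₀₁ (1 / 8) d) hBG₁ hθW₁ hcΔ₁ hA₀₁ hAH₁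
      (thetaD_nonneg hε₃₁.le hq₁) hqG₁
  have hKc₂ : 0 ≤ const190 1 1 b3₂.κ BG₂ θW₂ cΔ₂ A₀₂ AH₂
      (d * Real.exp (1 / 2 * d * δ₀₂) *
        ((1 - (C3Gen d L * (((L : ℝ) ^ h) ^ 2 * (2 * ε₃₂)) * (2 * d) * Bk₂ * Real.exp (2 * d * δ₀₂)) *
            (d * B6.c0 δ₀₂ (1 / 2) ^ d))⁻¹ * (Real.exp (d * δ₀₂) * (C3Gen d L * ((L : ℝ) ^ h) ^ 2 * (2 * ε₃₂)))))
      (B6.c0 δ₀₂ (1 / 8) ^ d) :=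
    const190_nonneg' zero_le_one zero_le_one b3₂.κ_nonneg (c0_pow_nonneg δ₀₂ (1 / 8) d) hBG₂ hθW₂ hcΔ₂ hA₀₂ hAH₂
      (thetaD_nonneg hε₃₂.le hq₂) hqG₂
  have hrow₁ : RowSum (cubeGeometry L h S₁ T₁) (a₁ * δ₀₁) (B6.c0 δ₀₁ a₁ ^ d) := rowSum_cubeGeometry L h S₁ T₁ (mul_pos ha₁ hδ₀₁)
  have hrow₂ : RowSum (cubeGeometry L h S₂ T₂) (a₂ * δ₀₂) (B6.c0 δ₀₂ a₂ ^ d) := rowSum_cubeGeometry L h S₂ T₂ (mul_pos ha₂ hδ₀₂)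
  subst hHf₁ hHf₂
  exact ineq198_twoSup_of_ineq190_layer199_twoGeom (boxT L h S₁ T₁) (blkT L h S₁ T₁) dep pt dir box₁ blk₁ y₀₁ Sc₁
    (boxT L h S₂ T₂) (blkT L h S₂ T₂) box₂ blk₂ y₀₂ Sc₂ h190₁₀ h190₁₁ h190₂₀ h190₂₁ hKc₁ hKc₂
    (dist_nonneg_cubeGeometry L h S₁ T₁) (dist_nonneg_cubeGeometry L h S₂ T₂) hrow₁ hτ haτ₁ y₁ hrow₂ ha₂8 y₂ hL hd1 hAG hhk
    U₀' U' hU₀' hU' hε hCw hδ0 lo hi hlohi h96 h80 hD hXc hX1 hδr hsmall hs3 hs2 hs6 h19 h82 hX hfar₁ B' hB' hξ hCc hH₁sa hg₁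
    hC₀ hH₂sa hg₂ hrep μ ν x hmv₁₀ hmv₁₁ hmv₂₀ hmv₂₁ hgeom₁ hCB₁ hCB₂ hB₃ hδM hδM2 hεj hflowB hβ₀ hβ₁ hr hR hgh hgγ hγe hγB
    hεk hrj hs0 hδ'k hrk hflowC hγC hx₁ hxμ₁ hxν₁ hS₁₁ hS₂₁ hx₂ hxμ₂ hxν₂ hS₁₂ hS₂₂ h180 hα' hL0 hL1 hε1 hXst he hscale hLkj1

end Eq198C

/-! ## §3 (1.98) p. 200 END TO END FROM THE LOCATED LEAVES OF [15] SECT. G, the two schemes on TWO block geometries (the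
two-geometry form of `B15From190SectG.ineq198_twoSup_layer199_sectG`) -/

section Pairs

variable {X : Type} [Fintype X]
variable {𝒴 𝒵 : Type} [NormedAddCommGroup 𝒴] [NormedSpace ℂ 𝒴] [NormedAddCommGroup 𝒵] [NormedSpace ℂ 𝒵]
  [CompleteSpace 𝒴] [CompleteSpace 𝒵] {gB : B6.Geometry}
variable {𝔸 : Type} [NormedRing 𝔸] [NormedAlgebra ℂ 𝔸] [CompleteSpace 𝔸]
  {𝒢 : 𝒵 →L[ℂ] 𝒴} {W : 𝒴 → 𝒵} {D2 : 𝒴 →L[ℂ] 𝒵} {H₀ : (X → 𝔸) →L[ℂ] 𝒴} {B₀ θ C₄ a₃ 𝔧 𝔞 ε₄ : ℝ}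
  {E : Type} [NormedAddCommGroup E] [NormedSpace ℝ E]

/-- **The end-to-end pair for the SUP output size, input size `supSize gB boxB blkB` on `X → 𝔸`** (`κ_B = 1`, `hBloc` from
`i ∈ boxB (blkB i)`): r08's `B11Ineq190Actual.ineq190_and_hmv_supSize_sectG` for the canonical presentation of the (179) chart,
together with `0 ≤ const190 1 …` (verbatim the private helper of `B15From190SectG`).
[cite: Balaban1985Variational, Prop. 9 (190) pp.308–309, (179)–(180) p.306] -/
private theorem pair_sup_sectG (Reg : Regime 𝒢 0 W B₀ θ C₄ a₃ 𝔧 𝔞 ε₄) (hWa : AnalyticOnNhd ℂ W {Y : 𝒴 | ‖Y‖ < a₃})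
    {D : 𝒴 → X → 𝔸} (H : (X → 𝔸) →L[ℂ] 𝒴) (hTm : AnalyticOnNhd ℂ (fun Y : 𝒴 => Y - H (D Y)) {Y : 𝒴 | ‖Y‖ < ε₄ + 𝔞})
    (hTm0 : (0 : 𝒴) - H (D 0) = 0) {B : X → 𝔸} (hB : ‖H₀ B‖ < 𝔞 ∧ ‖D2 (H₀ B)‖ < 𝔧)
    (boxB : gB.Site → Finset X) (blkB : X → gB.Site) (hcover : ∀ i, i ∈ boxB (blkB i))
    {Xo : Type} (box : gB.Site → Finset Xo) (blk : Xo → gB.Site) (ev : Xo → (𝒴 →L[ℝ] E))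
    {bN : BlockNorm gB 𝒴} {b3 : BlockNorm gB 𝒵}
    (hev : ∀ (y : gB.Site) (v : 𝒴), ∀ x ∈ box y, ‖ev x v‖ ≤ bN.loc y v)
    (hN : ∀ (y : gB.Site) (v : 𝒴), bN.loc y v ≤ ‖v‖)
    {δ₀ BG θW cΔ A₀ AH θD c : ℝ}
    (htri : Triangle254 gB) (hd : ∀ a b : gB.Site, 0 ≤ gB.dist a b) (hδ₀ : 0 ≤ δ₀) (hrow8 : RowSum gB (δ₀ / 8) c)
    (hc : 0 ≤ c) (hBG : 0 ≤ BG) (hθW : 0 ≤ θW) (hcΔ : 0 ≤ cΔ) (hA₀ : 0 ≤ A₀) (hAH : 0 ≤ AH) (hθD : 0 ≤ θD)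
    (hG : HasMaj b3 bN (𝒢.restrictScalars ℝ : 𝒵 →ₗ[ℝ] 𝒴) (fun y y' => BG * Real.exp (-(δ₀ * gB.dist y y'))))
    (hD2H0 : HasMaj (supSize (X := X) (E := 𝔸) gB boxB blkB) b3 ((D2 ∘L H₀).restrictScalars ℝ : (X → 𝔸) →ₗ[ℝ] 𝒵)
      (fun y y' => cΔ * Real.exp (-(δ₀ * gB.dist y y'))))
    (hH0 : HasMaj (supSize (X := X) (E := 𝔸) gB boxB blkB) bN (H₀.restrictScalars ℝ : (X → 𝔸) →ₗ[ℝ] 𝒴)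
      (fun y y' => A₀ * Real.exp (-(δ₀ * gB.dist y y'))))
    (hH : HasMaj (supSize (X := X) (E := 𝔸) gB boxB blkB) bN (H.restrictScalars ℝ : (X → 𝔸) →ₗ[ℝ] 𝒴)
      (fun y y' => AH * Real.exp (-(δ₀ / 2 * gB.dist y y'))))
    (h189 : ∀ B' : X → 𝔸, ‖H₀ B'‖ < 𝔞 → ‖D2 (H₀ B')‖ < 𝔧 →
      Ineq189 bN b3 ((fderiv ℂ W (solA180 𝒢 W D2 H₀ ε₄ B' + H₀ B')).restrictScalars ℝ : 𝒴 →ₗ[ℝ] 𝒵) θW δ₀)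
    (hDfr : ∀ B' : X → 𝔸, ‖H₀ B'‖ < 𝔞 → ‖D2 (H₀ B')‖ < 𝔧 →
      ∃ 𝔇 : 𝒴 →L[ℂ] (X → 𝔸), HasFDerivAt D 𝔇 (solA180 𝒢 W D2 H₀ ε₄ B' + H₀ B') ∧
        HasMaj bN (supSize (X := X) (E := 𝔸) gB boxB blkB) (𝔇.restrictScalars ℝ : 𝒴 →ₗ[ℝ] (X → 𝔸))
          (fun y y' => θD * Real.exp (-(δ₀ / 2 * gB.dist y y'))))
    (hq : qG b3.κ bN.κ BG θW c < 1) (y : gB.Site) :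
    0 ≤ const190 1 bN.κ b3.κ BG θW cΔ A₀ AH θD c ∧
    (∀ t : Icc (0:ℝ) 1, Ineq190 (supSize (X := X) (E := 𝔸) gB boxB blkB) (supSize gB box blk : BlockNorm gB (Xo → E))
        ((LinearMap.pi fun x => ((ev x : 𝒴 →L[ℝ] E) : 𝒴 →ₗ[ℝ] E)) ∘ₗ
          ((fderiv ℂ (chartH179 𝒢 W D2 H₀ (fun Y : 𝒴 => Y - H (D Y)) ε₄) ((t : ℝ) • B)).restrictScalars ℝ :
            (X → 𝔸) →ₗ[ℝ] 𝒴))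
        (const190 1 bN.κ b3.κ BG θW cΔ A₀ AH θD c) δ₀) ∧
      ∀ s : ℝ, (∀ t : Icc (0:ℝ) 1, (supSize gB box blk : BlockNorm gB (Xo → E)).loc y
          (((LinearMap.pi fun x => ((ev x : 𝒴 →L[ℝ] E) : 𝒴 →ₗ[ℝ] E)) ∘ₗ
            ((fderiv ℂ (chartH179 𝒢 W D2 H₀ (fun Y : 𝒴 => Y - H (D Y)) ε₄) ((t : ℝ) • B)).restrictScalars ℝ :
              (X → 𝔸) →ₗ[ℝ] 𝒴)) B) ≤ s) →
        (supSize gB box blk : BlockNorm gB (Xo → E)).loc y (fun x => ev x (chartH179 𝒢 W D2 H₀ (fun Y : 𝒴 => Y - H (D Y)) ε₄ B))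
          ≤ s := by
  have hBloc : ∀ (y' : gB.Site) (μ : X → 𝔸), (supSize (X := X) (E := 𝔸) gB boxB blkB).IsLoc y' μ →
      ‖μ‖ ≤ (supSize (X := X) (E := 𝔸) gB boxB blkB).loc y' μ :=
    fun y' μ hμ => B14From190SectG.norm_le_loc_supSize_of_isLoc hcover hμ
  obtain ⟨h190, hmv⟩ := ineq190_and_hmv_supSize_sectG (box := box) (blk := blk) Reg hWa H hTm hTm0 hB ev hev hN hBloc htri
    hd hδ₀ hrow8 hc hBG hθW hcΔ hA₀ hAH hθD hG hD2H0 hH0 hH h189 hDfr hq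
    (fun B' => fun x => ev x (chartH179 𝒢 W D2 H₀ (fun Y : 𝒴 => Y - H (D Y)) ε₄ B'))
    (fun t => (LinearMap.pi fun x => ((ev x : 𝒴 →L[ℝ] E) : 𝒴 →ₗ[ℝ] E)) ∘ₗ
      ((fderiv ℂ (chartH179 𝒢 W D2 H₀ (fun Y : 𝒴 => Y - H (D Y)) ε₄) ((t : ℝ) • B)).restrictScalars ℝ : (X → 𝔸) →ₗ[ℝ] 𝒴))
    (fun _ => rfl) (fun _ => rfl) y
  rw [supSize_κ] at h190
  exact ⟨const190_nonneg' zero_le_one bN.κ_nonneg b3.κ_nonneg hc hBG hθW hcΔ hA₀ hAH hθD hq, h190, hmv⟩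

/-- **The end-to-end pair for the FIRST-ORDER output size `covDerivBlockSize gB y₀ S ξ U₀`, input size `supSize gB boxB blkB` on
`X → 𝔸`**: p29's `B11Ineq190ActualDeriv.ineq190_and_hmv_covDerivBlockSize_sectG` for the canonical presentation, `hBloc` discharged,
`κ_B = 1` (verbatim the private helper of `B15From190SectG`).
[cite: Balaban1985Variational, Prop. 9 (190) pp.308–309, (179)–(180) p.306, (115) p.294] -/
private theorem pair_cov_sectG (Reg : Regime 𝒢 0 W B₀ θ C₄ a₃ 𝔧 𝔞 ε₄) (hWa : AnalyticOnNhd ℂ W {Y : 𝒴 | ‖Y‖ < a₃})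
    {D : 𝒴 → X → 𝔸} (H : (X → 𝔸) →L[ℂ] 𝒴) (hTm : AnalyticOnNhd ℂ (fun Y : 𝒴 => Y - H (D Y)) {Y : 𝒴 | ‖Y‖ < ε₄ + 𝔞})
    (hTm0 : (0 : 𝒴) - H (D 0) = 0) {B : X → 𝔸} (hB : ‖H₀ B‖ < 𝔞 ∧ ‖D2 (H₀ B)‖ < 𝔧)
    (boxB : gB.Site → Finset X) (blkB : X → gB.Site) (hcover : ∀ i, i ∈ boxB (blkB i))
    (y₀ : gB.Site) (S : gB.Site → Finset (B7Prop1Explicit.Site d × Fin d × Fin d)) {ξ : ℝ}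
    {U₀ : B7Prop1Explicit.Site d → Fin d → 𝔸ˣ} (ev : B7Prop1Explicit.Site d → (𝒴 →L[ℝ] (Fin d → 𝔸)))
    {bN : BlockNorm gB 𝒴} {b3 : BlockNorm gB 𝒵}
    (hev₁ : ∀ (y : gB.Site) (v : 𝒴), (covDerivBlockSize gB y₀ S ξ U₀).loc y (fun x => ev x v) ≤ bN.loc y v)
    (hN : ∀ (y : gB.Site) (v : 𝒴), bN.loc y v ≤ ‖v‖)
    {δ₀ BG θW cΔ A₀ AH θD c : ℝ}
    (htri : Triangle254 gB) (hd : ∀ a b : gB.Site, 0 ≤ gB.dist a b) (hδ₀ : 0 ≤ δ₀) (hrow8 : RowSum gB (δ₀ / 8) c)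
    (hc : 0 ≤ c) (hBG : 0 ≤ BG) (hθW : 0 ≤ θW) (hcΔ : 0 ≤ cΔ) (hA₀ : 0 ≤ A₀) (hAH : 0 ≤ AH) (hθD : 0 ≤ θD)
    (hG : HasMaj b3 bN (𝒢.restrictScalars ℝ : 𝒵 →ₗ[ℝ] 𝒴) (fun y y' => BG * Real.exp (-(δ₀ * gB.dist y y'))))
    (hD2H0 : HasMaj (supSize (X := X) (E := 𝔸) gB boxB blkB) b3 ((D2 ∘L H₀).restrictScalars ℝ : (X → 𝔸) →ₗ[ℝ] 𝒵)
      (fun y y' => cΔ * Real.exp (-(δ₀ * gB.dist y y'))))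
    (hH0 : HasMaj (supSize (X := X) (E := 𝔸) gB boxB blkB) bN (H₀.restrictScalars ℝ : (X → 𝔸) →ₗ[ℝ] 𝒴)
      (fun y y' => A₀ * Real.exp (-(δ₀ * gB.dist y y'))))
    (hH : HasMaj (supSize (X := X) (E := 𝔸) gB boxB blkB) bN (H.restrictScalars ℝ : (X → 𝔸) →ₗ[ℝ] 𝒴)
      (fun y y' => AH * Real.exp (-(δ₀ / 2 * gB.dist y y'))))
    (h189 : ∀ B' : X → 𝔸, ‖H₀ B'‖ < 𝔞 → ‖D2 (H₀ B')‖ < 𝔧 →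
      Ineq189 bN b3 ((fderiv ℂ W (solA180 𝒢 W D2 H₀ ε₄ B' + H₀ B')).restrictScalars ℝ : 𝒴 →ₗ[ℝ] 𝒵) θW δ₀)
    (hDfr : ∀ B' : X → 𝔸, ‖H₀ B'‖ < 𝔞 → ‖D2 (H₀ B')‖ < 𝔧 →
      ∃ 𝔇 : 𝒴 →L[ℂ] (X → 𝔸), HasFDerivAt D 𝔇 (solA180 𝒢 W D2 H₀ ε₄ B' + H₀ B') ∧
        HasMaj bN (supSize (X := X) (E := 𝔸) gB boxB blkB) (𝔇.restrictScalars ℝ : 𝒴 →ₗ[ℝ] (X → 𝔸))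
          (fun y y' => θD * Real.exp (-(δ₀ / 2 * gB.dist y y'))))
    (hq : qG b3.κ bN.κ BG θW c < 1) (y : gB.Site) :
    (∀ t : Icc (0:ℝ) 1, Ineq190 (supSize (X := X) (E := 𝔸) gB boxB blkB) (covDerivBlockSize gB y₀ S ξ U₀)
        ((LinearMap.pi fun x => ((ev x : 𝒴 →L[ℝ] (Fin d → 𝔸)) : 𝒴 →ₗ[ℝ] (Fin d → 𝔸))) ∘ₗ
          ((fderiv ℂ (chartH179 𝒢 W D2 H₀ (fun Y : 𝒴 => Y - H (D Y)) ε₄) ((t : ℝ) • B)).restrictScalars ℝ :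
            (X → 𝔸) →ₗ[ℝ] 𝒴))
        (const190 1 bN.κ b3.κ BG θW cΔ A₀ AH θD c) δ₀) ∧
      ∀ s : ℝ, (∀ t : Icc (0:ℝ) 1, (covDerivBlockSize gB y₀ S ξ U₀).loc y
          (((LinearMap.pi fun x => ((ev x : 𝒴 →L[ℝ] (Fin d → 𝔸)) : 𝒴 →ₗ[ℝ] (Fin d → 𝔸))) ∘ₗ
            ((fderiv ℂ (chartH179 𝒢 W D2 H₀ (fun Y : 𝒴 => Y - H (D Y)) ε₄) ((t : ℝ) • B)).restrictScalars ℝ :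
              (X → 𝔸) →ₗ[ℝ] 𝒴)) B) ≤ s) →
        (covDerivBlockSize gB y₀ S ξ U₀).loc y (fun x => ev x (chartH179 𝒢 W D2 H₀ (fun Y : 𝒴 => Y - H (D Y)) ε₄ B))
          ≤ s := by
  have hBloc : ∀ (y' : gB.Site) (μ : X → 𝔸), (supSize (X := X) (E := 𝔸) gB boxB blkB).IsLoc y' μ →
      ‖μ‖ ≤ (supSize (X := X) (E := 𝔸) gB boxB blkB).loc y' μ :=
    fun y' μ hμ => B14From190SectG.norm_le_loc_supSize_of_isLoc hcover hμ
  obtain ⟨h190, hmv⟩ := ineq190_and_hmv_covDerivBlockSize_sectG (y₀ := y₀) (S := S) (ξ := ξ) (U₀ := U₀) Reg hWa H hTm hTm0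
    hB ev hev₁ hN hBloc htri hd hδ₀ hrow8 hc hBG hθW hcΔ hA₀ hAH hθD hG hD2H0 hH0 hH h189 hDfr hq
    (fun B' => fun x => ev x (chartH179 𝒢 W D2 H₀ (fun Y : 𝒴 => Y - H (D Y)) ε₄ B'))
    (fun t => (LinearMap.pi fun x => ((ev x : 𝒴 →L[ℝ] (Fin d → 𝔸)) : 𝒴 →ₗ[ℝ] (Fin d → 𝔸))) ∘ₗ
      ((fderiv ℂ (chartH179 𝒢 W D2 H₀ (fun Y : 𝒴 => Y - H (D Y)) ε₄) ((t : ℝ) • B)).restrictScalars ℝ : (X → 𝔸) →ₗ[ℝ] 𝒴))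
    (fun _ => rfl) (fun _ => rfl) y
  rw [supSize_κ] at h190
  exact ⟨h190, hmv⟩

end Pairs

section Eq198G

variable {X₁ X₂ : Type} [Fintype X₁] [Fintype X₂]
variable {𝒴₁ 𝒵₁ 𝒴₂ 𝒵₂ : Type} [NormedAddCommGroup 𝒴₁] [NormedSpace ℂ 𝒴₁] [NormedAddCommGroup 𝒵₁] [NormedSpace ℂ 𝒵₁]
  [CompleteSpace 𝒴₁] [CompleteSpace 𝒵₁] [NormedAddCommGroup 𝒴₂] [NormedSpace ℂ 𝒴₂] [NormedAddCommGroup 𝒵₂]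
  [NormedSpace ℂ 𝒵₂] [CompleteSpace 𝒴₂] [CompleteSpace 𝒵₂] {gB₁ gB₂ : B6.Geometry}
variable {𝔸 : Type} [CStarAlgebra 𝔸] [Nontrivial 𝔸]
  {𝒢₁ : 𝒵₁ →L[ℂ] 𝒴₁} {W₁ : 𝒴₁ → 𝒵₁} {D2₁ : 𝒴₁ →L[ℂ] 𝒵₁} {H₀₁ : (X₁ → 𝔸) →L[ℂ] 𝒴₁} {B₀₁ θ₁ C₄₁ a₃₁ 𝔧₁ 𝔞₁ ε₄₁ : ℝ}
  {𝒢₂ : 𝒵₂ →L[ℂ] 𝒴₂} {W₂ : 𝒴₂ → 𝒵₂} {D2₂ : 𝒴₂ →L[ℂ] 𝒵₂} {H₀₂ : (X₂ → 𝔸) →L[ℂ] 𝒴₂} {B₀₂ θ₂ C₄₂ a₃₂ 𝔧₂ 𝔞₂ ε₄₂ : ℝ}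

/-- **(1.98) p. 200 ON THE LATTICE, BOTH p. 199 `ℍ`-CHAINS END TO END FROM THE LOCATED LEAVES OF [15] SECT. G, the two schemes on
TWO block geometries** — `B15From190SectG.ineq198_twoSup_layer199_sectG` (r12 gen 11, p308026: two ABSTRACT schemes of [15] — two
backgrounds ⇒ two spaces (115), two sets of operators, indices ₁, ₂ — sharing ONE geometry `gB`, one `δ₀`, one [3] datum `c` and one output
presentation) with, in addition, the block geometry `gBᵢ`, [3] (2.54) `htriᵢ`, the decay rate `δ₀ᵢ`, the Lemma 2.1 constant `cᵢ` (`RowSum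
gBᵢ σᵢ cᵢ`), the output presentation (`boxᵢ`, `blkᵢ`, `y₀ᵢ`, `Sᵢ`, the presentation letters `hevᵢ₀`/`hevᵢ₁`/`hNᵢ`) and the block `yᵢ` of the
plaquette SEPARATE for the two schemes (§1's knit in place of §10 of `B15From190LayerSizes`); the eight located hypotheses `h190ᵢ₀`,
`h190ᵢ₁`, `hmvᵢ₀`, `hmvᵢ₁` are SUPPLIED by r08's `B11Ineq190Actual.ineq190_and_hmv_supSize_sectG` / p29's
`B11Ineq190ActualDeriv.ineq190_and_hmv_covDerivBlockSize_sectG` per scheme ([15] Sect. G (182)–(190) for the ACTUAL Fréchet derivative of the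
(179) chart), `hBloc` from `i ∈ boxBᵢ (blkBᵢ i)` (r11's `norm_le_loc_supSize_of_isLoc`).  Remaining: r08's located leaves of Sect. G of BOTH
schemes (regime, analyticity and Sect. C letters `hTmᵢ`/`hTm0ᵢ`, abstract majorant letters `hGᵢ`/`hD2H0ᵢ`/`hH0ᵢ`/`hHᵢ`, (189), (73)
`hDfrᵢ`, `qᵢ < 1`, the domain conditions `hdomᵢ`), the presentation letters, and §1's side conditions verbatim; one printed `B₃` dominates
both explicit weights `const190ᵢ · cᵢ`.  The landed one-geometry theorem is the diagonal `gB₁ = gB₂` of this one.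
[cite: Balaban1989LargeFieldI, (1.97)–(1.98) pp.199–200, (1.80) p.195, (1.82) p.196; Balaban1985Variational, Prop. 9 (190) pp.308–309, (179)–(180) p.306, (115) p.294; Balaban1984PropagatorsII, (2.54) p.233, Lemma 2.1 (2.61) p.234] -/
theorem ineq198_twoSup_layer199_twoGeom_sectG
    -- scheme 1 (chain 1, background `C` of (1.97)): regime, analyticity letters, Sect. C map
    (Reg₁ : Regime 𝒢₁ 0 W₁ B₀₁ θ₁ C₄₁ a₃₁ 𝔧₁ 𝔞₁ ε₄₁) (hWa₁ : AnalyticOnNhd ℂ W₁ {Y : 𝒴₁ | ‖Y‖ < a₃₁})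
    {Dm₁ : 𝒴₁ → X₁ → 𝔸} (Hm₁ : (X₁ → 𝔸) →L[ℂ] 𝒴₁)
    (hTm₁ : AnalyticOnNhd ℂ (fun Y : 𝒴₁ => Y - Hm₁ (Dm₁ Y)) {Y : 𝒴₁ | ‖Y‖ < ε₄₁ + 𝔞₁}) (hTm0₁ : (0 : 𝒴₁) - Hm₁ (Dm₁ 0) = 0)
    -- scheme 2 (chain 2, background `C₀ = U₀^{ū₀}`)
    (Reg₂ : Regime 𝒢₂ 0 W₂ B₀₂ θ₂ C₄₂ a₃₂ 𝔧₂ 𝔞₂ ε₄₂) (hWa₂ : AnalyticOnNhd ℂ W₂ {Y : 𝒴₂ | ‖Y‖ < a₃₂})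
    {Dm₂ : 𝒴₂ → X₂ → 𝔸} (Hm₂ : (X₂ → 𝔸) →L[ℂ] 𝒴₂)
    (hTm₂ : AnalyticOnNhd ℂ (fun Y : 𝒴₂ => Y - Hm₂ (Dm₂ Y)) {Y : 𝒴₂ | ‖Y‖ < ε₄₂ + 𝔞₂}) (hTm0₂ : (0 : 𝒴₂) - Hm₂ (Dm₂ 0) = 0)
    -- chain 1's argument field: p29's two-field layer tower (fine fields `U′`, `U₀′`), in the domain of (180) of scheme 1
    (dep : X₁ → ℕ) (pt : X₁ → B7Prop1Explicit.Site d) (dir : X₁ → Fin d)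
    {L : ℕ} (hL : 2 ≤ L) (hd1 : 1 ≤ d) {G : Subgroup 𝔸ˣ} (hAG : AvgClosed d L G) {h k j : ℕ} (hhk : h ≤ k)
    (U₀' U' : B7Prop1Explicit.Site d → Fin d → 𝔸ˣ) (hU₀' : ∀ x κ, U₀' x κ ∈ G) (hU' : ∀ x κ, U' x κ ∈ G)
    (hdom₁ : ‖H₀₁ (fun i => mlog (((avgIter L U' (h - dep i) (pt i) (dir i) *
          (avgIter L U₀' (h - dep i) (pt i) (dir i))⁻¹ : 𝔸ˣ) : 𝔸)))‖ < 𝔞₁ ∧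
      ‖D2₁ (H₀₁ (fun i => mlog (((avgIter L U' (h - dep i) (pt i) (dir i) *
          (avgIter L U₀' (h - dep i) (pt i) (dir i))⁻¹ : 𝔸ˣ) : 𝔸))))‖ < 𝔧₁)
    -- chain 2's argument field `B′` under (1.82), in the domain of (180) of scheme 2
    {δ'k : ℝ} (B' : X₂ → 𝔸) (hB' : ∀ i, ‖B' i‖ ≤ δ'k) (hdom₂ : ‖H₀₂ B'‖ < 𝔞₂ ∧ ‖D2₂ (H₀₂ B')‖ < 𝔧₂)
    -- input sizes and output presentations, each scheme on its own geometry (backgrounds `Cc` = `C`, `C₀`)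
    (boxB₁ : gB₁.Site → Finset X₁) (blkB₁ : X₁ → gB₁.Site) (hcover₁ : ∀ i, i ∈ boxB₁ (blkB₁ i))
    (boxB₂ : gB₂.Site → Finset X₂) (blkB₂ : X₂ → gB₂.Site) (hcover₂ : ∀ i, i ∈ boxB₂ (blkB₂ i))
    (box₁ : gB₁.Site → Finset (B7Prop1Explicit.Site d)) (blk₁ : B7Prop1Explicit.Site d → gB₁.Site)
    (y₀₁ : gB₁.Site) (S₁ : gB₁.Site → Finset (B7Prop1Explicit.Site d × Fin d × Fin d))
    (box₂ : gB₂.Site → Finset (B7Prop1Explicit.Site d)) (blk₂ : B7Prop1Explicit.Site d → gB₂.Site)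
    (y₀₂ : gB₂.Site) (S₂ : gB₂.Site → Finset (B7Prop1Explicit.Site d × Fin d × Fin d)) {ξ : ℝ}
    {Cc C₀ : B7Prop1Explicit.Site d → Fin d → 𝔸ˣ}
    (ev₁ : B7Prop1Explicit.Site d → (𝒴₁ →L[ℝ] (Fin d → 𝔸))) (ev₂ : B7Prop1Explicit.Site d → (𝒴₂ →L[ℝ] (Fin d → 𝔸)))
    {bN₁ : BlockNorm gB₁ 𝒴₁} {b3₁ : BlockNorm gB₁ 𝒵₁} {bN₂ : BlockNorm gB₂ 𝒴₂} {b3₂ : BlockNorm gB₂ 𝒵₂}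
    (hev₁₀ : ∀ (y : gB₁.Site) (v : 𝒴₁), ∀ x ∈ box₁ y, ‖ev₁ x v‖ ≤ bN₁.loc y v)
    (hev₁₁ : ∀ (y : gB₁.Site) (v : 𝒴₁), (covDerivBlockSize gB₁ y₀₁ S₁ ξ Cc).loc y (fun x => ev₁ x v) ≤ bN₁.loc y v)
    (hN₁ : ∀ (y : gB₁.Site) (v : 𝒴₁), bN₁.loc y v ≤ ‖v‖)
    (hev₂₀ : ∀ (y : gB₂.Site) (v : 𝒴₂), ∀ x ∈ box₂ y, ‖ev₂ x v‖ ≤ bN₂.loc y v)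
    (hev₂₁ : ∀ (y : gB₂.Site) (v : 𝒴₂), (covDerivBlockSize gB₂ y₀₂ S₂ ξ C₀).loc y (fun x => ev₂ x v) ≤ bN₂.loc y v)
    (hN₂ : ∀ (y : gB₂.Site) (v : 𝒴₂), bN₂.loc y v ≤ ‖v‖)
    -- the located leaves of [15] Sect. G, scheme 1 on geometry 1
    {δ₀₁ δ₀₂ c₁ c₂ BG₁ θW₁ cΔ₁ A₀₁ AH₁ θD₁ BG₂ θW₂ cΔ₂ A₀₂ AH₂ θD₂ : ℝ}
    (htri₁ : Triangle254 gB₁) (hd₁ : ∀ a b : gB₁.Site, 0 ≤ gB₁.dist a b) (hδ₀₁ : 0 ≤ δ₀₁) (hc₁ : 0 ≤ c₁)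
    (hBG₁ : 0 ≤ BG₁) (hθW₁ : 0 ≤ θW₁) (hcΔ₁ : 0 ≤ cΔ₁) (hA₀₁ : 0 ≤ A₀₁) (hAH₁ : 0 ≤ AH₁) (hθD₁ : 0 ≤ θD₁)
    (hG₁ : HasMaj b3₁ bN₁ (𝒢₁.restrictScalars ℝ : 𝒵₁ →ₗ[ℝ] 𝒴₁) (fun y y' => BG₁ * Real.exp (-(δ₀₁ * gB₁.dist y y'))))
    (hD2H0₁ : HasMaj (supSize (X := X₁) (E := 𝔸) gB₁ boxB₁ blkB₁) b3₁ ((D2₁ ∘L H₀₁).restrictScalars ℝ : (X₁ → 𝔸) →ₗ[ℝ] 𝒵₁)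
      (fun y y' => cΔ₁ * Real.exp (-(δ₀₁ * gB₁.dist y y'))))
    (hH0₁ : HasMaj (supSize (X := X₁) (E := 𝔸) gB₁ boxB₁ blkB₁) bN₁ (H₀₁.restrictScalars ℝ : (X₁ → 𝔸) →ₗ[ℝ] 𝒴₁)
      (fun y y' => A₀₁ * Real.exp (-(δ₀₁ * gB₁.dist y y'))))
    (hH₁ : HasMaj (supSize (X := X₁) (E := 𝔸) gB₁ boxB₁ blkB₁) bN₁ (Hm₁.restrictScalars ℝ : (X₁ → 𝔸) →ₗ[ℝ] 𝒴₁)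
      (fun y y' => AH₁ * Real.exp (-(δ₀₁ / 2 * gB₁.dist y y'))))
    (h189₁ : ∀ B'' : X₁ → 𝔸, ‖H₀₁ B''‖ < 𝔞₁ → ‖D2₁ (H₀₁ B'')‖ < 𝔧₁ →
      Ineq189 bN₁ b3₁ ((fderiv ℂ W₁ (solA180 𝒢₁ W₁ D2₁ H₀₁ ε₄₁ B'' + H₀₁ B'')).restrictScalars ℝ : 𝒴₁ →ₗ[ℝ] 𝒵₁) θW₁ δ₀₁)
    (hDfr₁ : ∀ B'' : X₁ → 𝔸, ‖H₀₁ B''‖ < 𝔞₁ → ‖D2₁ (H₀₁ B'')‖ < 𝔧₁ →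
      ∃ 𝔇 : 𝒴₁ →L[ℂ] (X₁ → 𝔸), HasFDerivAt Dm₁ 𝔇 (solA180 𝒢₁ W₁ D2₁ H₀₁ ε₄₁ B'' + H₀₁ B'') ∧
        HasMaj bN₁ (supSize (X := X₁) (E := 𝔸) gB₁ boxB₁ blkB₁) (𝔇.restrictScalars ℝ : 𝒴₁ →ₗ[ℝ] (X₁ → 𝔸))
          (fun y y' => θD₁ * Real.exp (-(δ₀₁ / 2 * gB₁.dist y y'))))
    (hq₁ : qG b3₁.κ bN₁.κ BG₁ θW₁ c₁ < 1)
    -- the located leaves of [15] Sect. G, scheme 2 on geometry 2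
    (htri₂ : Triangle254 gB₂) (hd₂ : ∀ a b : gB₂.Site, 0 ≤ gB₂.dist a b) (hδ₀₂ : 0 ≤ δ₀₂) (hc₂ : 0 ≤ c₂)
    (hBG₂ : 0 ≤ BG₂) (hθW₂ : 0 ≤ θW₂) (hcΔ₂ : 0 ≤ cΔ₂) (hA₀₂ : 0 ≤ A₀₂) (hAH₂ : 0 ≤ AH₂) (hθD₂ : 0 ≤ θD₂)
    (hG₂ : HasMaj b3₂ bN₂ (𝒢₂.restrictScalars ℝ : 𝒵₂ →ₗ[ℝ] 𝒴₂) (fun y y' => BG₂ * Real.exp (-(δ₀₂ * gB₂.dist y y'))))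
    (hD2H0₂ : HasMaj (supSize (X := X₂) (E := 𝔸) gB₂ boxB₂ blkB₂) b3₂ ((D2₂ ∘L H₀₂).restrictScalars ℝ : (X₂ → 𝔸) →ₗ[ℝ] 𝒵₂)
      (fun y y' => cΔ₂ * Real.exp (-(δ₀₂ * gB₂.dist y y'))))
    (hH0₂ : HasMaj (supSize (X := X₂) (E := 𝔸) gB₂ boxB₂ blkB₂) bN₂ (H₀₂.restrictScalars ℝ : (X₂ → 𝔸) →ₗ[ℝ] 𝒴₂)
      (fun y y' => A₀₂ * Real.exp (-(δ₀₂ * gB₂.dist y y'))))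
    (hH₂ : HasMaj (supSize (X := X₂) (E := 𝔸) gB₂ boxB₂ blkB₂) bN₂ (Hm₂.restrictScalars ℝ : (X₂ → 𝔸) →ₗ[ℝ] 𝒴₂)
      (fun y y' => AH₂ * Real.exp (-(δ₀₂ / 2 * gB₂.dist y y'))))
    (h189₂ : ∀ B'' : X₂ → 𝔸, ‖H₀₂ B''‖ < 𝔞₂ → ‖D2₂ (H₀₂ B'')‖ < 𝔧₂ →
      Ineq189 bN₂ b3₂ ((fderiv ℂ W₂ (solA180 𝒢₂ W₂ D2₂ H₀₂ ε₄₂ B'' + H₀₂ B'')).restrictScalars ℝ : 𝒴₂ →ₗ[ℝ] 𝒵₂) θW₂ δ₀₂)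
    (hDfr₂ : ∀ B'' : X₂ → 𝔸, ‖H₀₂ B''‖ < 𝔞₂ → ‖D2₂ (H₀₂ B'')‖ < 𝔧₂ →
      ∃ 𝔇 : 𝒴₂ →L[ℂ] (X₂ → 𝔸), HasFDerivAt Dm₂ 𝔇 (solA180 𝒢₂ W₂ D2₂ H₀₂ ε₄₂ B'' + H₀₂ B'') ∧
        HasMaj bN₂ (supSize (X := X₂) (E := 𝔸) gB₂ boxB₂ blkB₂) (𝔇.restrictScalars ℝ : 𝒴₂ →ₗ[ℝ] (X₂ → 𝔸))
          (fun y y' => θD₂ * Real.exp (-(δ₀₂ / 2 * gB₂.dist y y'))))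
    (hq₂ : qG b3₂.κ bN₂.κ BG₂ θW₂ c₂ < 1)
    -- the [IV] side: the letters of §1 minus the eight located hypotheses; the two knit row sums
    {σ₁ σ₂ τ D₁ B₃ δ M M₁ εh εj εk γ gh β₀ α' rk rj s : ℝ} {r R : ℕ}
    (hrow₁ : RowSum gB₁ σ₁ c₁) (hτ : 0 ≤ τ) (hστ₁ : σ₁ + τ ≤ δ₀₁ / 8) (y₁ : gB₁.Site)
    (hrow₂ : RowSum gB₂ σ₂ c₂) (hσ₂ : σ₂ ≤ δ₀₂ / 8) (y₂ : gB₂.Site)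
    {Cw Xc rr : ℝ} (hε : 0 < εh) (hCw : 0 ≤ Cw) (hδ0 : 0 ≤ δ'k) (lo hi : B7Prop1Explicit.Site d) (hlohi : lo ≤ hi)
    (h96 : pdevOn (tlo L lo h) (thi L hi h) U' < 3 / 4 * εh * (((L : ℝ) ^ h)⁻¹) ^ 2)
    (h80 : pdevOn (tlo L lo h) (thi L hi h) U₀' < Cw * εk * (((L : ℝ) ^ k)⁻¹) ^ 2)
    (hD : εk ≤ (1 + β₀) * Real.sqrt (k - h : ℕ) * εh)
    (hXc : Xc = (((L : ℝ) ^ (k - h)) ^ 2)⁻¹ * Real.sqrt (k - h : ℕ) * Cw * (1 + β₀)) (hX1 : Xc ≤ 1)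
    (hδr : δ'k ≤ (1 + β₀) * Real.sqrt (k - h : ℕ) * rr * εh)
    (hsmall : 2 * (1 + β₀) * Real.sqrt (k - h : ℕ) * rr < (d : ℝ) ^ 2)
    (hs3 : C0 d * εh ≤ 1 / 3) (hs2 : 2 * εh ≤ c2' d L) (hs6 : 11 * (d : ℝ) ^ 2 * εh + δ'k ≤ 1 / 6)
    (h19 : ∀ n, n < h → ∀ z, tlo L lo n ≤ z → z ≤ thi L hi n → ∀ r : Fin d → Fin L,
      axialFn (avgIter L U' (h - (n + 1))) ((L : ℤ) • z) ((L : ℤ) • z + boxVec L r) =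
        axialFn (avgIter L U₀' (h - (n + 1))) ((L : ℤ) • z) ((L : ℤ) • z + boxVec L r))
    (h82 : ∀ x ν, lo ≤ x → x + e ν ≤ hi →
      ‖((avgIter L U' h x ν * (avgIter L U₀' h x ν)⁻¹ : 𝔸ˣ) : 𝔸) - 1‖ ≤ δ'k)
    (hX : ∀ i, dep i ≤ h ∧ tlo L lo (dep i) ≤ pt i ∧ pt i + e (dir i) ≤ thi L hi (dep i))
    (hfar₁ : ∀ y' i, i ∈ boxB₁ y' → D₁ ≤ gB₁.dist y₁ y')
    (hξ : 0 < ξ) (hCc : ∀ z κ, Cc z κ ∈ U1 𝔸)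
    {Hf₁ : B7Prop1Explicit.Site d → Fin d → 𝔸}
    (hHf₁ : Hf₁ = fun x => ev₁ x (chartH179 𝒢₁ W₁ D2₁ H₀₁ (fun Y : 𝒴₁ => Y - Hm₁ (Dm₁ Y)) ε₄₁
      (fun i => mlog (((avgIter L U' (h - dep i) (pt i) (dir i) *
          (avgIter L U₀' (h - dep i) (pt i) (dir i))⁻¹ : 𝔸ˣ) : 𝔸)))))
    (hH₁sa : ∀ z κ, IsSelfAdjoint (Hf₁ z κ))
    {g₁ : B7Prop1Explicit.Site d → 𝔸ˣ} (hg₁ : ∀ z, g₁ z ∈ U1 𝔸)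
    (hC₀ : ∀ z κ, C₀ z κ ∈ U1 𝔸)
    {Hf₂ : B7Prop1Explicit.Site d → Fin d → 𝔸}
    (hHf₂ : Hf₂ = fun x => ev₂ x (chartH179 𝒢₂ W₂ D2₂ H₀₂ (fun Y : 𝒴₂ => Y - Hm₂ (Dm₂ Y)) ε₄₂ B'))
    (hH₂sa : ∀ z κ, IsSelfAdjoint (Hf₂ z κ))
    {g₂ : B7Prop1Explicit.Site d → 𝔸ˣ} (hg₂ : ∀ z, g₂ z ∈ U1 𝔸)
    (hrep : Cc = gaugeAct g₂ (B8Lemma1NonAbelian.mulCfg (B8Eq146AExpansion.expCfg (B8Eq146AExpansion.iEta ξ Hf₂)) C₀))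
    (μ ν : Fin d) (x : B7Prop1Explicit.Site d) {Linv η B₅ dist Cst Lkj : ℝ}
    (hgeom₁ : δ * (M / M₁) * ((j - h : ℕ) : ℝ) + δ * M / 2 * (R : ℝ) ≤ τ * D₁)
    (hCB₁ : const190 1 bN₁.κ b3₁.κ BG₁ θW₁ cΔ₁ A₀₁ AH₁ θD₁ c₁ * c₁ ≤ B₃)
    (hCB₂ : const190 1 bN₂.κ b3₂.κ BG₂ θW₂ cΔ₂ A₀₂ AH₂ θD₂ c₂ * c₂ ≤ B₃) (hB₃ : 0 < B₃)
    (hδM : 1 ≤ δ * (M / M₁)) (hδM2 : 1 ≤ δ * M / 2) (hεj : 0 < εj)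
    (hflowB : εh ≤ (1 + β₀) ^ 2 * (1 + ((j - h : ℕ) : ℝ) ^ β₀) * εj) (hβ₀ : 0 < β₀) (hβ₁ : β₀ ≤ 1)
    (hr : 1 ≤ r) (hR : B14.IsRj L r gh R) (hgh : 0 < gh) (hgγ : gh ≤ γ) (hγe : 1 ≤ Real.log (γ ^ 2)⁻¹)
    (hγB : 23 * (d : ℝ) ^ 2 * B₃ * (1 + β₀) ^ 2 * γ ^ 2 < α')
    (hεk : 0 ≤ εk) (hrj : 0 ≤ rj) (hs0 : 0 ≤ s) (hδ'k : δ'k ≤ rk * εk) (hrk : rk ≤ rj)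
    (hflowC : εk ≤ (1 + β₀) * (1 + s) * εj) (hγC : B₃ * (1 + β₀) * (1 + s) * rj < α')
    (hx₁ : x ∈ box₁ y₁) (hxμ₁ : x + e μ ∈ box₁ y₁) (hxν₁ : x + e ν ∈ box₁ y₁)
    (hS₁₁ : (x, μ, ν) ∈ S₁ y₁) (hS₂₁ : (x, ν, μ) ∈ S₁ y₁)
    (hx₂ : x ∈ box₂ y₂) (hxμ₂ : x + e μ ∈ box₂ y₂) (hxν₂ : x + e ν ∈ box₂ y₂)
    (hS₁₂ : (x, μ, ν) ∈ S₂ y₂) (hS₂₂ : (x, ν, μ) ∈ S₂ y₂)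
    (h180 : B15.Ineq180 ‖B8Ineq132.plaqF C₀ μ ν x - 1‖ εk η B₃ B₅ M δ dist Cst)
    (hα' : 2 * α' ≤ 1 / 8) (hL0 : 0 ≤ Linv) (hL1 : Linv ≤ 1) (hε1 : εj ≤ 1 / 10)
    (hXst : 0 ≤ Cst * B₃ * B₅ * M ^ 5 * Real.exp (-δ * dist)) (he : 0 ≤ εk * η ^ 2)
    (hscale : εk * η ^ 2 ≤ Lkj * (εj * ξ ^ 2)) (hLkj1 : Lkj ≤ 1) :
    ‖B8Ineq132.plaqF (gaugeAct g₁ (B8Lemma1NonAbelian.mulCfg (B8Eq146AExpansion.expCfg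
        (B8Eq146AExpansion.iEta ξ Hf₁)) Cc)) μ ν x - 1‖
      < (2 * Lkj + 4 * (2 * α') + Cst * (1 + Linv * (2 * α') * εj) ^ 2 * B₃ * B₅ * M ^ 5 * Real.exp (-δ * dist) * Lkj)
        * (εj * ξ ^ 2) := by
  have hrow8₁ : RowSum gB₁ (δ₀₁ / 8) c₁ := hrow₁.mono hd₁ (by linarith)
  have hrow8₂ : RowSum gB₂ (δ₀₂ / 8) c₂ := hrow₂.mono hd₂ hσ₂
  -- scheme 1 on geometry 1: the two pairs for `ℍ₁` (sup size, covariant derivatives at `Cc`)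
  obtain ⟨hK₁, h190₁₀, hmv₁₀⟩ := pair_sup_sectG Reg₁ hWa₁ Hm₁ hTm₁ hTm0₁ hdom₁ boxB₁ blkB₁ hcover₁ box₁ blk₁ ev₁ hev₁₀ hN₁
    htri₁ hd₁ hδ₀₁ hrow8₁ hc₁ hBG₁ hθW₁ hcΔ₁ hA₀₁ hAH₁ hθD₁ hG₁ hD2H0₁ hH0₁ hH₁ h189₁ hDfr₁ hq₁ y₁
  obtain ⟨h190₁₁, hmv₁₁⟩ := pair_cov_sectG Reg₁ hWa₁ Hm₁ hTm₁ hTm0₁ hdom₁ boxB₁ blkB₁ hcover₁ y₀₁ S₁ ev₁ hev₁₁ hN₁ htri₁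
    hd₁ hδ₀₁ hrow8₁ hc₁ hBG₁ hθW₁ hcΔ₁ hA₀₁ hAH₁ hθD₁ hG₁ hD2H0₁ hH0₁ hH₁ h189₁ hDfr₁ hq₁ y₁
  -- scheme 2 on geometry 2: the two pairs for `ℍ₂` (sup size, covariant derivatives at `C₀`)
  obtain ⟨hK₂, h190₂₀, hmv₂₀⟩ := pair_sup_sectG Reg₂ hWa₂ Hm₂ hTm₂ hTm0₂ hdom₂ boxB₂ blkB₂ hcover₂ box₂ blk₂ ev₂ hev₂₀ hN₂
    htri₂ hd₂ hδ₀₂ hrow8₂ hc₂ hBG₂ hθW₂ hcΔ₂ hA₀₂ hAH₂ hθD₂ hG₂ hD2H0₂ hH0₂ hH₂ h189₂ hDfr₂ hq₂ y₂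
  obtain ⟨h190₂₁, hmv₂₁⟩ := pair_cov_sectG Reg₂ hWa₂ Hm₂ hTm₂ hTm0₂ hdom₂ boxB₂ blkB₂ hcover₂ y₀₂ S₂ ev₂ hev₂₁ hN₂ htri₂
    hd₂ hδ₀₂ hrow8₂ hc₂ hBG₂ hθW₂ hcΔ₂ hA₀₂ hAH₂ hθD₂ hG₂ hD2H0₂ hH0₂ hH₂ h189₂ hDfr₂ hq₂ y₂
  subst hHf₁ hHf₂
  exact ineq198_twoSup_of_ineq190_layer199_twoGeom boxB₁ blkB₁ dep pt dir box₁ blk₁ y₀₁ S₁ boxB₂ blkB₂ box₂ blk₂ y₀₂ S₂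
    h190₁₀ h190₁₁ h190₂₀ h190₂₁ hK₁ hK₂ hd₁ hd₂ hrow₁ hτ hστ₁ y₁ hrow₂ hσ₂ y₂ hL hd1 hAG hhk U₀' U' hU₀' hU' hε hCw hδ0 lo
    hi hlohi h96 h80 hD hXc hX1 hδr hsmall hs3 hs2 hs6 h19 h82 hX hfar₁ B' hB' hξ hCc hH₁sa hg₁ hC₀ hH₂sa hg₂ hrep μ ν x
    hmv₁₀ hmv₁₁ hmv₂₀ hmv₂₁ hgeom₁ hCB₁ hCB₂ hB₃ hδM hδM2 hεj hflowB hβ₀ hβ₁ hr hR hgh hgγ hγe hγB hεk hrj hs0 hδ'k hrk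
    hflowC hγC hx₁ hxμ₁ hxν₁ hS₁₁ hS₂₁ hx₂ hxμ₂ hxν₂ hS₁₂ hS₂₂ h180 hα' hL0 hL1 hε1 hXst he hscale hLkj1

end Eq198G

/-! ## §4 (v1.1) (1.98) END TO END FROM [15] SECT. G AND PROPOSITION 3, two schemes on two geometries: §3 with the Sect. C
letters of BOTH schemes (`hTmᵢ`, `hTm0ᵢ`, the differentiability half of `hDfrᵢ`) taken at `Dmᵢ := Dfix Cmᵢ Hmᵢ C₂ᵢ` from r08's
`B11Ineq190FromProp3` (the (1.98) member of the `_of_inputs` pattern of `B15From190SectG` §9) -/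

section OfInputs

open B11Ineq190FromProp3 B11Prop3Model

variable {X₁ X₂ : Type} [Fintype X₁] [Fintype X₂]
variable {𝒴₁ 𝒵₁ 𝒴₂ 𝒵₂ : Type} [NormedAddCommGroup 𝒴₁] [NormedSpace ℂ 𝒴₁] [NormedAddCommGroup 𝒵₁] [NormedSpace ℂ 𝒵₁]
  [CompleteSpace 𝒴₁] [CompleteSpace 𝒵₁] [NormedAddCommGroup 𝒴₂] [NormedSpace ℂ 𝒴₂] [NormedAddCommGroup 𝒵₂]
  [NormedSpace ℂ 𝒵₂] [CompleteSpace 𝒴₂] [CompleteSpace 𝒵₂] {gB₁ gB₂ : B6.Geometry}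
variable {𝔸 : Type} [CStarAlgebra 𝔸] [Nontrivial 𝔸]
  {𝒢₁ : 𝒵₁ →L[ℂ] 𝒴₁} {W₁ : 𝒴₁ → 𝒵₁} {D2₁ : 𝒴₁ →L[ℂ] 𝒵₁} {H₀₁ : (X₁ → 𝔸) →L[ℂ] 𝒴₁} {B₀₁ θ₁ C₄₁ a₃₁ 𝔧₁ 𝔞₁ ε₄₁ : ℝ}
  {𝒢₂ : 𝒵₂ →L[ℂ] 𝒴₂} {W₂ : 𝒴₂ → 𝒵₂} {D2₂ : 𝒴₂ →L[ℂ] 𝒵₂} {H₀₂ : (X₂ → 𝔸) →L[ℂ] 𝒴₂} {B₀₂ θ₂ C₄₂ a₃₂ 𝔧₂ 𝔞₂ ε₄₂ : ℝ}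
  {Cm₁ : 𝒴₁ → X₁ → 𝔸} {Hm₁ : (X₁ → 𝔸) →L[ℂ] 𝒴₁} {C₂₁ C₃₁ B₀'₁ c₄₁ ε₃₁ : ℝ}
  {Cm₂ : 𝒴₂ → X₂ → 𝔸} {Hm₂ : (X₂ → 𝔸) →L[ℂ] 𝒴₂} {C₂₂ C₃₂ B₀'₂ c₄₂ ε₃₂ : ℝ}

/-- **(1.98) END TO END FROM [15] SECT. G AND PROPOSITION 3, the two schemes on TWO block geometries** — §3's
`ineq198_twoSup_layer199_twoGeom_sectG` with, for EACH scheme, the Sect. C transformation `Tmᵢ = · − Hmᵢ(Dmᵢ ·)` taken at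
`Dmᵢ := B11Prop3Model.Dfix Cmᵢ Hmᵢ C₂ᵢ` (THE solution of [15] (49) for the analytic map `Cmᵢ` of (44) and the linear map `Hmᵢ` of
(46)): its three letters `hTmᵢ` (analytic on `‖Y‖ < ε₄ᵢ + 𝔞ᵢ`), `hTm0ᵢ` (`Tmᵢ 0 = 0`) and the differentiability half of `hDfrᵢ` are
r08's theorems from Proposition 3's inputs (`B11Prop3Model.Inputs Cmᵢ Hmᵢ C₂ᵢ C₃ᵢ B₀′ᵢ c₄ᵢ`), the analyticity of `Cmᵢ` on `‖Y‖ < 2c₄ᵢ`,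
the printed smallness `18C₂ᵢB₀′ᵢε₃ᵢ ≤ 1`, `2ε₃ᵢ ≤ c₄ᵢ` and the nesting `ε₄ᵢ + 𝔞ᵢ ≤ ε₃ᵢ` (`B11Ineq190FromProp3.analyticOnNhd_Tm_of_le`,
`Tm_zero`, `hasFDerivAt_Dfix_of_lt`, `norm_arg180_lt_eps3`); the (73) letter of each scheme is the decay majorant `h73ᵢ` of the actual
derivative of `Dfix` on the domain.  Everything else as in §3 (the pattern of `B15From190SectG.ineq131_lt_layer_of_inputs`, here for
(1.98) and per scheme).
[cite: Balaban1989LargeFieldI, (1.97)–(1.98) pp.199–200; Balaban1985Variational, Prop. 9 (190) pp.308–309, Prop. 3 p.289, (44)/(46) p.285, (49) p.285, (73) p.289, (179)–(180) p.306] -/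
theorem ineq198_twoSup_layer199_twoGeom_of_inputs
    -- scheme 1: regime, analyticity of `W₁`, Prop. 3 inputs for (Cm₁, Hm₁)
    (Reg₁ : Regime 𝒢₁ 0 W₁ B₀₁ θ₁ C₄₁ a₃₁ 𝔧₁ 𝔞₁ ε₄₁) (hWa₁ : AnalyticOnNhd ℂ W₁ {Y : 𝒴₁ | ‖Y‖ < a₃₁})
    (hin₁ : Inputs Cm₁ (Hm₁ : (X₁ → 𝔸) →ₗ[ℂ] 𝒴₁) C₂₁ C₃₁ B₀'₁ c₄₁) (hCa₁ : AnalyticOnNhd ℂ Cm₁ {Y : 𝒴₁ | ‖Y‖ < 2 * c₄₁})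
    (hC₂₁ : 0 ≤ C₂₁) (hC₃₁ : 0 ≤ C₃₁) (hB₀'₁ : 0 ≤ B₀'₁) (hε₃₁ : 0 < ε₃₁) (h18₁ : 18 * C₂₁ * B₀'₁ * ε₃₁ ≤ 1)
    (h2₁ : 2 * ε₃₁ ≤ c₄₁) (hnest₁ : ε₄₁ + 𝔞₁ ≤ ε₃₁)
    -- scheme 2: the same for (Cm₂, Hm₂)
    (Reg₂ : Regime 𝒢₂ 0 W₂ B₀₂ θ₂ C₄₂ a₃₂ 𝔧₂ 𝔞₂ ε₄₂) (hWa₂ : AnalyticOnNhd ℂ W₂ {Y : 𝒴₂ | ‖Y‖ < a₃₂})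
    (hin₂ : Inputs Cm₂ (Hm₂ : (X₂ → 𝔸) →ₗ[ℂ] 𝒴₂) C₂₂ C₃₂ B₀'₂ c₄₂) (hCa₂ : AnalyticOnNhd ℂ Cm₂ {Y : 𝒴₂ | ‖Y‖ < 2 * c₄₂})
    (hC₂₂ : 0 ≤ C₂₂) (hC₃₂ : 0 ≤ C₃₂) (hB₀'₂ : 0 ≤ B₀'₂) (hε₃₂ : 0 < ε₃₂) (h18₂ : 18 * C₂₂ * B₀'₂ * ε₃₂ ≤ 1)
    (h2₂ : 2 * ε₃₂ ≤ c₄₂) (hnest₂ : ε₄₂ + 𝔞₂ ≤ ε₃₂)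
    -- chain 1's argument field: p29's two-field layer tower (fine fields `U′`, `U₀′`), in the domain of (180) of scheme 1
    (dep : X₁ → ℕ) (pt : X₁ → B7Prop1Explicit.Site d) (dir : X₁ → Fin d)
    {L : ℕ} (hL : 2 ≤ L) (hd1 : 1 ≤ d) {G : Subgroup 𝔸ˣ} (hAG : AvgClosed d L G) {h k j : ℕ} (hhk : h ≤ k)
    (U₀' U' : B7Prop1Explicit.Site d → Fin d → 𝔸ˣ) (hU₀' : ∀ x κ, U₀' x κ ∈ G) (hU' : ∀ x κ, U' x κ ∈ G)
    (hdom₁ : ‖H₀₁ (fun i => mlog (((avgIter L U' (h - dep i) (pt i) (dir i) *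
          (avgIter L U₀' (h - dep i) (pt i) (dir i))⁻¹ : 𝔸ˣ) : 𝔸)))‖ < 𝔞₁ ∧
      ‖D2₁ (H₀₁ (fun i => mlog (((avgIter L U' (h - dep i) (pt i) (dir i) *
          (avgIter L U₀' (h - dep i) (pt i) (dir i))⁻¹ : 𝔸ˣ) : 𝔸))))‖ < 𝔧₁)
    -- chain 2's argument field `B′` under (1.82), in the domain of (180) of scheme 2
    {δ'k : ℝ} (B' : X₂ → 𝔸) (hB' : ∀ i, ‖B' i‖ ≤ δ'k) (hdom₂ : ‖H₀₂ B'‖ < 𝔞₂ ∧ ‖D2₂ (H₀₂ B')‖ < 𝔧₂)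
    -- input sizes and output presentations, each scheme on its own geometry (backgrounds `Cc` = `C`, `C₀`)
    (boxB₁ : gB₁.Site → Finset X₁) (blkB₁ : X₁ → gB₁.Site) (hcover₁ : ∀ i, i ∈ boxB₁ (blkB₁ i))
    (boxB₂ : gB₂.Site → Finset X₂) (blkB₂ : X₂ → gB₂.Site) (hcover₂ : ∀ i, i ∈ boxB₂ (blkB₂ i))
    (box₁ : gB₁.Site → Finset (B7Prop1Explicit.Site d)) (blk₁ : B7Prop1Explicit.Site d → gB₁.Site)
    (y₀₁ : gB₁.Site) (S₁ : gB₁.Site → Finset (B7Prop1Explicit.Site d × Fin d × Fin d))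
    (box₂ : gB₂.Site → Finset (B7Prop1Explicit.Site d)) (blk₂ : B7Prop1Explicit.Site d → gB₂.Site)
    (y₀₂ : gB₂.Site) (S₂ : gB₂.Site → Finset (B7Prop1Explicit.Site d × Fin d × Fin d)) {ξ : ℝ}
    {Cc C₀ : B7Prop1Explicit.Site d → Fin d → 𝔸ˣ}
    (ev₁ : B7Prop1Explicit.Site d → (𝒴₁ →L[ℝ] (Fin d → 𝔸))) (ev₂ : B7Prop1Explicit.Site d → (𝒴₂ →L[ℝ] (Fin d → 𝔸)))
    {bN₁ : BlockNorm gB₁ 𝒴₁} {b3₁ : BlockNorm gB₁ 𝒵₁} {bN₂ : BlockNorm gB₂ 𝒴₂} {b3₂ : BlockNorm gB₂ 𝒵₂}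
    (hev₁₀ : ∀ (y : gB₁.Site) (v : 𝒴₁), ∀ x ∈ box₁ y, ‖ev₁ x v‖ ≤ bN₁.loc y v)
    (hev₁₁ : ∀ (y : gB₁.Site) (v : 𝒴₁), (covDerivBlockSize gB₁ y₀₁ S₁ ξ Cc).loc y (fun x => ev₁ x v) ≤ bN₁.loc y v)
    (hN₁ : ∀ (y : gB₁.Site) (v : 𝒴₁), bN₁.loc y v ≤ ‖v‖)
    (hev₂₀ : ∀ (y : gB₂.Site) (v : 𝒴₂), ∀ x ∈ box₂ y, ‖ev₂ x v‖ ≤ bN₂.loc y v)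
    (hev₂₁ : ∀ (y : gB₂.Site) (v : 𝒴₂), (covDerivBlockSize gB₂ y₀₂ S₂ ξ C₀).loc y (fun x => ev₂ x v) ≤ bN₂.loc y v)
    (hN₂ : ∀ (y : gB₂.Site) (v : 𝒴₂), bN₂.loc y v ≤ ‖v‖)
    -- the located leaves of [15] Sect. G, scheme 1 on geometry 1, with the (73) letter for the actual derivative of `Dfix`
    {δ₀₁ δ₀₂ c₁ c₂ BG₁ θW₁ cΔ₁ A₀₁ AH₁ θD₁ BG₂ θW₂ cΔ₂ A₀₂ AH₂ θD₂ : ℝ}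
    (htri₁ : Triangle254 gB₁) (hd₁ : ∀ a b : gB₁.Site, 0 ≤ gB₁.dist a b) (hδ₀₁ : 0 ≤ δ₀₁) (hc₁ : 0 ≤ c₁)
    (hBG₁ : 0 ≤ BG₁) (hθW₁ : 0 ≤ θW₁) (hcΔ₁ : 0 ≤ cΔ₁) (hA₀₁ : 0 ≤ A₀₁) (hAH₁ : 0 ≤ AH₁) (hθD₁ : 0 ≤ θD₁)
    (hG₁ : HasMaj b3₁ bN₁ (𝒢₁.restrictScalars ℝ : 𝒵₁ →ₗ[ℝ] 𝒴₁) (fun y y' => BG₁ * Real.exp (-(δ₀₁ * gB₁.dist y y'))))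
    (hD2H0₁ : HasMaj (supSize (X := X₁) (E := 𝔸) gB₁ boxB₁ blkB₁) b3₁ ((D2₁ ∘L H₀₁).restrictScalars ℝ : (X₁ → 𝔸) →ₗ[ℝ] 𝒵₁)
      (fun y y' => cΔ₁ * Real.exp (-(δ₀₁ * gB₁.dist y y'))))
    (hH0₁ : HasMaj (supSize (X := X₁) (E := 𝔸) gB₁ boxB₁ blkB₁) bN₁ (H₀₁.restrictScalars ℝ : (X₁ → 𝔸) →ₗ[ℝ] 𝒴₁)
      (fun y y' => A₀₁ * Real.exp (-(δ₀₁ * gB₁.dist y y'))))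
    (hH₁ : HasMaj (supSize (X := X₁) (E := 𝔸) gB₁ boxB₁ blkB₁) bN₁ (Hm₁.restrictScalars ℝ : (X₁ → 𝔸) →ₗ[ℝ] 𝒴₁)
      (fun y y' => AH₁ * Real.exp (-(δ₀₁ / 2 * gB₁.dist y y'))))
    (h189₁ : ∀ B'' : X₁ → 𝔸, ‖H₀₁ B''‖ < 𝔞₁ → ‖D2₁ (H₀₁ B'')‖ < 𝔧₁ →
      Ineq189 bN₁ b3₁ ((fderiv ℂ W₁ (solA180 𝒢₁ W₁ D2₁ H₀₁ ε₄₁ B'' + H₀₁ B'')).restrictScalars ℝ : 𝒴₁ →ₗ[ℝ] 𝒵₁) θW₁ δ₀₁)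
    (h73₁ : ∀ B'' : X₁ → 𝔸, ‖H₀₁ B''‖ < 𝔞₁ → ‖D2₁ (H₀₁ B'')‖ < 𝔧₁ →
      HasMaj bN₁ (supSize (X := X₁) (E := 𝔸) gB₁ boxB₁ blkB₁)
        ((fderiv ℂ (Dfix Cm₁ (Hm₁ : (X₁ → 𝔸) →ₗ[ℂ] 𝒴₁) C₂₁) (solA180 𝒢₁ W₁ D2₁ H₀₁ ε₄₁ B'' + H₀₁ B'')).restrictScalars ℝ :
          𝒴₁ →ₗ[ℝ] (X₁ → 𝔸))
        (fun y y' => θD₁ * Real.exp (-(δ₀₁ / 2 * gB₁.dist y y'))))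
    (hq₁ : qG b3₁.κ bN₁.κ BG₁ θW₁ c₁ < 1)
    -- the located leaves of [15] Sect. G, scheme 2 on geometry 2
    (htri₂ : Triangle254 gB₂) (hd₂ : ∀ a b : gB₂.Site, 0 ≤ gB₂.dist a b) (hδ₀₂ : 0 ≤ δ₀₂) (hc₂ : 0 ≤ c₂)
    (hBG₂ : 0 ≤ BG₂) (hθW₂ : 0 ≤ θW₂) (hcΔ₂ : 0 ≤ cΔ₂) (hA₀₂ : 0 ≤ A₀₂) (hAH₂ : 0 ≤ AH₂) (hθD₂ : 0 ≤ θD₂)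
    (hG₂ : HasMaj b3₂ bN₂ (𝒢₂.restrictScalars ℝ : 𝒵₂ →ₗ[ℝ] 𝒴₂) (fun y y' => BG₂ * Real.exp (-(δ₀₂ * gB₂.dist y y'))))
    (hD2H0₂ : HasMaj (supSize (X := X₂) (E := 𝔸) gB₂ boxB₂ blkB₂) b3₂ ((D2₂ ∘L H₀₂).restrictScalars ℝ : (X₂ → 𝔸) →ₗ[ℝ] 𝒵₂)
      (fun y y' => cΔ₂ * Real.exp (-(δ₀₂ * gB₂.dist y y'))))
    (hH0₂ : HasMaj (supSize (X := X₂) (E := 𝔸) gB₂ boxB₂ blkB₂) bN₂ (H₀₂.restrictScalars ℝ : (X₂ → 𝔸) →ₗ[ℝ] 𝒴₂)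
      (fun y y' => A₀₂ * Real.exp (-(δ₀₂ * gB₂.dist y y'))))
    (hH₂ : HasMaj (supSize (X := X₂) (E := 𝔸) gB₂ boxB₂ blkB₂) bN₂ (Hm₂.restrictScalars ℝ : (X₂ → 𝔸) →ₗ[ℝ] 𝒴₂)
      (fun y y' => AH₂ * Real.exp (-(δ₀₂ / 2 * gB₂.dist y y'))))
    (h189₂ : ∀ B'' : X₂ → 𝔸, ‖H₀₂ B''‖ < 𝔞₂ → ‖D2₂ (H₀₂ B'')‖ < 𝔧₂ →
      Ineq189 bN₂ b3₂ ((fderiv ℂ W₂ (solA180 𝒢₂ W₂ D2₂ H₀₂ ε₄₂ B'' + H₀₂ B'')).restrictScalars ℝ : 𝒴₂ →ₗ[ℝ] 𝒵₂) θW₂ δ₀₂)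
    (h73₂ : ∀ B'' : X₂ → 𝔸, ‖H₀₂ B''‖ < 𝔞₂ → ‖D2₂ (H₀₂ B'')‖ < 𝔧₂ →
      HasMaj bN₂ (supSize (X := X₂) (E := 𝔸) gB₂ boxB₂ blkB₂)
        ((fderiv ℂ (Dfix Cm₂ (Hm₂ : (X₂ → 𝔸) →ₗ[ℂ] 𝒴₂) C₂₂) (solA180 𝒢₂ W₂ D2₂ H₀₂ ε₄₂ B'' + H₀₂ B'')).restrictScalars ℝ :
          𝒴₂ →ₗ[ℝ] (X₂ → 𝔸))
        (fun y y' => θD₂ * Real.exp (-(δ₀₂ / 2 * gB₂.dist y y'))))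
    (hq₂ : qG b3₂.κ bN₂.κ BG₂ θW₂ c₂ < 1)
    -- the [IV] side, as in §3
    {σ₁ σ₂ τ D₁ B₃ δ M M₁ εh εj εk γ gh β₀ α' rk rj s : ℝ} {r R : ℕ}
    (hrow₁ : RowSum gB₁ σ₁ c₁) (hτ : 0 ≤ τ) (hστ₁ : σ₁ + τ ≤ δ₀₁ / 8) (y₁ : gB₁.Site)
    (hrow₂ : RowSum gB₂ σ₂ c₂) (hσ₂ : σ₂ ≤ δ₀₂ / 8) (y₂ : gB₂.Site)
    {Cw Xc rr : ℝ} (hε : 0 < εh) (hCw : 0 ≤ Cw) (hδ0 : 0 ≤ δ'k) (lo hi : B7Prop1Explicit.Site d) (hlohi : lo ≤ hi)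
    (h96 : pdevOn (tlo L lo h) (thi L hi h) U' < 3 / 4 * εh * (((L : ℝ) ^ h)⁻¹) ^ 2)
    (h80 : pdevOn (tlo L lo h) (thi L hi h) U₀' < Cw * εk * (((L : ℝ) ^ k)⁻¹) ^ 2)
    (hD : εk ≤ (1 + β₀) * Real.sqrt (k - h : ℕ) * εh)
    (hXc : Xc = (((L : ℝ) ^ (k - h)) ^ 2)⁻¹ * Real.sqrt (k - h : ℕ) * Cw * (1 + β₀)) (hX1 : Xc ≤ 1)
    (hδr : δ'k ≤ (1 + β₀) * Real.sqrt (k - h : ℕ) * rr * εh)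
    (hsmall : 2 * (1 + β₀) * Real.sqrt (k - h : ℕ) * rr < (d : ℝ) ^ 2)
    (hs3 : C0 d * εh ≤ 1 / 3) (hs2 : 2 * εh ≤ c2' d L) (hs6 : 11 * (d : ℝ) ^ 2 * εh + δ'k ≤ 1 / 6)
    (h19 : ∀ n, n < h → ∀ z, tlo L lo n ≤ z → z ≤ thi L hi n → ∀ r : Fin d → Fin L,
      axialFn (avgIter L U' (h - (n + 1))) ((L : ℤ) • z) ((L : ℤ) • z + boxVec L r) =
        axialFn (avgIter L U₀' (h - (n + 1))) ((L : ℤ) • z) ((L : ℤ) • z + boxVec L r))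
    (h82 : ∀ x ν, lo ≤ x → x + e ν ≤ hi →
      ‖((avgIter L U' h x ν * (avgIter L U₀' h x ν)⁻¹ : 𝔸ˣ) : 𝔸) - 1‖ ≤ δ'k)
    (hX : ∀ i, dep i ≤ h ∧ tlo L lo (dep i) ≤ pt i ∧ pt i + e (dir i) ≤ thi L hi (dep i))
    (hfar₁ : ∀ y' i, i ∈ boxB₁ y' → D₁ ≤ gB₁.dist y₁ y')
    (hξ : 0 < ξ) (hCc : ∀ z κ, Cc z κ ∈ U1 𝔸)
    {Hf₁ : B7Prop1Explicit.Site d → Fin d → 𝔸}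
    (hHf₁ : Hf₁ = fun x => ev₁ x (chartH179 𝒢₁ W₁ D2₁ H₀₁
      (fun Y : 𝒴₁ => Y - Hm₁ (Dfix Cm₁ (Hm₁ : (X₁ → 𝔸) →ₗ[ℂ] 𝒴₁) C₂₁ Y)) ε₄₁
      (fun i => mlog (((avgIter L U' (h - dep i) (pt i) (dir i) *
          (avgIter L U₀' (h - dep i) (pt i) (dir i))⁻¹ : 𝔸ˣ) : 𝔸)))))
    (hH₁sa : ∀ z κ, IsSelfAdjoint (Hf₁ z κ))
    {g₁ : B7Prop1Explicit.Site d → 𝔸ˣ} (hg₁ : ∀ z, g₁ z ∈ U1 𝔸)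
    (hC₀ : ∀ z κ, C₀ z κ ∈ U1 𝔸)
    {Hf₂ : B7Prop1Explicit.Site d → Fin d → 𝔸}
    (hHf₂ : Hf₂ = fun x => ev₂ x (chartH179 𝒢₂ W₂ D2₂ H₀₂
      (fun Y : 𝒴₂ => Y - Hm₂ (Dfix Cm₂ (Hm₂ : (X₂ → 𝔸) →ₗ[ℂ] 𝒴₂) C₂₂ Y)) ε₄₂ B'))
    (hH₂sa : ∀ z κ, IsSelfAdjoint (Hf₂ z κ))
    {g₂ : B7Prop1Explicit.Site d → 𝔸ˣ} (hg₂ : ∀ z, g₂ z ∈ U1 𝔸)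
    (hrep : Cc = gaugeAct g₂ (B8Lemma1NonAbelian.mulCfg (B8Eq146AExpansion.expCfg (B8Eq146AExpansion.iEta ξ Hf₂)) C₀))
    (μ ν : Fin d) (x : B7Prop1Explicit.Site d) {Linv η B₅ dist Cst Lkj : ℝ}
    (hgeom₁ : δ * (M / M₁) * ((j - h : ℕ) : ℝ) + δ * M / 2 * (R : ℝ) ≤ τ * D₁)
    (hCB₁ : const190 1 bN₁.κ b3₁.κ BG₁ θW₁ cΔ₁ A₀₁ AH₁ θD₁ c₁ * c₁ ≤ B₃)
    (hCB₂ : const190 1 bN₂.κ b3₂.κ BG₂ θW₂ cΔ₂ A₀₂ AH₂ θD₂ c₂ * c₂ ≤ B₃) (hB₃ : 0 < B₃)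
    (hδM : 1 ≤ δ * (M / M₁)) (hδM2 : 1 ≤ δ * M / 2) (hεj : 0 < εj)
    (hflowB : εh ≤ (1 + β₀) ^ 2 * (1 + ((j - h : ℕ) : ℝ) ^ β₀) * εj) (hβ₀ : 0 < β₀) (hβ₁ : β₀ ≤ 1)
    (hr : 1 ≤ r) (hR : B14.IsRj L r gh R) (hgh : 0 < gh) (hgγ : gh ≤ γ) (hγe : 1 ≤ Real.log (γ ^ 2)⁻¹)
    (hγB : 23 * (d : ℝ) ^ 2 * B₃ * (1 + β₀) ^ 2 * γ ^ 2 < α')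
    (hεk : 0 ≤ εk) (hrj : 0 ≤ rj) (hs0 : 0 ≤ s) (hδ'k : δ'k ≤ rk * εk) (hrk : rk ≤ rj)
    (hflowC : εk ≤ (1 + β₀) * (1 + s) * εj) (hγC : B₃ * (1 + β₀) * (1 + s) * rj < α')
    (hx₁ : x ∈ box₁ y₁) (hxμ₁ : x + e μ ∈ box₁ y₁) (hxν₁ : x + e ν ∈ box₁ y₁)
    (hS₁₁ : (x, μ, ν) ∈ S₁ y₁) (hS₂₁ : (x, ν, μ) ∈ S₁ y₁)
    (hx₂ : x ∈ box₂ y₂) (hxμ₂ : x + e μ ∈ box₂ y₂) (hxν₂ : x + e ν ∈ box₂ y₂)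
    (hS₁₂ : (x, μ, ν) ∈ S₂ y₂) (hS₂₂ : (x, ν, μ) ∈ S₂ y₂)
    (h180 : B15.Ineq180 ‖B8Ineq132.plaqF C₀ μ ν x - 1‖ εk η B₃ B₅ M δ dist Cst)
    (hα' : 2 * α' ≤ 1 / 8) (hL0 : 0 ≤ Linv) (hL1 : Linv ≤ 1) (hε1 : εj ≤ 1 / 10)
    (hXst : 0 ≤ Cst * B₃ * B₅ * M ^ 5 * Real.exp (-δ * dist)) (he : 0 ≤ εk * η ^ 2)
    (hscale : εk * η ^ 2 ≤ Lkj * (εj * ξ ^ 2)) (hLkj1 : Lkj ≤ 1) :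
    ‖B8Ineq132.plaqF (gaugeAct g₁ (B8Lemma1NonAbelian.mulCfg (B8Eq146AExpansion.expCfg
        (B8Eq146AExpansion.iEta ξ Hf₁)) Cc)) μ ν x - 1‖
      < (2 * Lkj + 4 * (2 * α') + Cst * (1 + Linv * (2 * α') * εj) ^ 2 * B₃ * B₅ * M ^ 5 * Real.exp (-δ * dist) * Lkj)
        * (εj * ξ ^ 2) :=
  ineq198_twoSup_layer199_twoGeom_sectG Reg₁ hWa₁ (Dm₁ := Dfix Cm₁ (Hm₁ : (X₁ → 𝔸) →ₗ[ℂ] 𝒴₁) C₂₁) Hm₁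
    (analyticOnNhd_Tm_of_le hin₁ hCa₁ hC₂₁ hB₀'₁ hε₃₁ h18₁ h2₁ hnest₁) (Tm_zero hin₁ hC₂₁ hB₀'₁ hε₃₁ h18₁ h2₁)
    Reg₂ hWa₂ (Dm₂ := Dfix Cm₂ (Hm₂ : (X₂ → 𝔸) →ₗ[ℂ] 𝒴₂) C₂₂) Hm₂
    (analyticOnNhd_Tm_of_le hin₂ hCa₂ hC₂₂ hB₀'₂ hε₃₂ h18₂ h2₂ hnest₂) (Tm_zero hin₂ hC₂₂ hB₀'₂ hε₃₂ h18₂ h2₂)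
    dep pt dir hL hd1 hAG hhk U₀' U' hU₀' hU' hdom₁ B' hB' hdom₂ boxB₁ blkB₁ hcover₁ boxB₂ blkB₂ hcover₂ box₁ blk₁ y₀₁ S₁
    box₂ blk₂ y₀₂ S₂ ev₁ ev₂ hev₁₀ hev₁₁ hN₁ hev₂₀ hev₂₁ hN₂ htri₁ hd₁ hδ₀₁ hc₁ hBG₁ hθW₁ hcΔ₁ hA₀₁ hAH₁ hθD₁ hG₁ hD2H0₁
    hH0₁ hH₁ h189₁
    (fun B'' h𝔄 hJ => ⟨_, hasFDerivAt_Dfix_of_lt hin₁ hC₂₁ hC₃₁ hB₀'₁ hε₃₁ h18₁ h2₁ (norm_arg180_lt_eps3 Reg₁ hJ h𝔄 hnest₁),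
      h73₁ B'' h𝔄 hJ⟩)
    hq₁ htri₂ hd₂ hδ₀₂ hc₂ hBG₂ hθW₂ hcΔ₂ hA₀₂ hAH₂ hθD₂ hG₂ hD2H0₂ hH0₂ hH₂ h189₂
    (fun B'' h𝔄 hJ => ⟨_, hasFDerivAt_Dfix_of_lt hin₂ hC₂₂ hC₃₂ hB₀'₂ hε₃₂ h18₂ h2₂ (norm_arg180_lt_eps3 Reg₂ hJ h𝔄 hnest₂),
      h73₂ B'' h𝔄 hJ⟩)
    hq₂ hrow₁ hτ hστ₁ y₁ hrow₂ hσ₂ y₂ hε hCw hδ0 lo hi hlohi h96 h80 hD hXc hX1 hδr hsmall hs3 hs2 hs6 h19 h82 hX hfar₁ hξ hCc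
    hHf₁ hH₁sa hg₁ hC₀ hHf₂ hH₂sa hg₂ hrep μ ν x hgeom₁ hCB₁ hCB₂ hB₃ hδM hδM2 hεj hflowB hβ₀ hβ₁ hr hR hgh hgγ hγe hγB hεk hrj
    hs0 hδ'k hrk hflowC hγC hx₁ hxμ₁ hxν₁ hS₁₁ hS₂₁ hx₂ hxμ₂ hxν₂ hS₁₂ hS₂₂ h180 hα' hL0 hL1 hε1 hXst he hscale hLkj1

end OfInputs

end Literature.MathematicalPhysics.QuantumFieldTheory.Balaban1983to89.B15Ineq198ConcreteC
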